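import Literature.NumberTheory.EllipticCurves.GrossZagierSingularModuli
import Literature.NumberTheory.EllipticCurves.ComplexMultiplicationSingularModuliProofs
import Literature.NumberTheory.EllipticCurves.ComplexMultiplicationSingularModuliNonmaximal
import HarnessLib

/-!
# Gross–Zagier 1985, Theorem 1.3 at every pair of class-number-one fundamental discriminants:
# the thirty-five rational instances of `J(d₁,d₂)^8 = (∏ₓ F((d₁d₂ − x²)/4))^{w₁w₂}`, kernel-checked

Topic `NumberTheory/EllipticCurves` (singular moduli); theorem-only companion (no definition, no named
fact, D-0026) of `GrossZagierSingularModuli.lean`, which TYPES the theorem of B. H. Gross and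
D. B. Zagier, *On singular moduli*, J. reine angew. Math. 355 (1985), Theorem 1.3, in the restatement of
Lauter–Viray (IMRN 2015, §1) as the named fact `grossZagier1985_singularModuli`
(`J d₁ d₂ ^ 8 = (rhs d₁ d₂) ^ (w₁ w₂)` for coprime negative fundamental discriminants; `J`, `rhs`, `F`,
`ε = GrossZagier1985.eps`, `w = unitCount` as defined there), and proves four instances of it, three of
them under the hypothesis `(h : singularModuli_classNumberOne)` (the table of the nine rational singular
moduli of the maximal orders of class number one, Cox §12.C (12.20)) — a named fact that is by now a
THEOREM of the tree (`singularModuli_classNumberOne_holds`, file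
`ComplexMultiplicationSingularModuliProofs.lean`; the four non-maximal rows
`singularModuli_nonmaximalOrders_holds`, file `ComplexMultiplicationSingularModuliNonmaximal.lean`).

This file records, UNCONDITIONALLY and sorry-free:

* `kleinJ_heegnerTau_principalForm` — for each of the thirteen class-number-one discriminants `D`
  (`classNumberOneDiscrs`), Klein's `j` at the CM point `τ_P` of the principal form `P` of discriminant
  `D` is the tabulated rational singular modulus `singularModulus D` (Cox §12.C table (12.20)); and the
  thirteen explicit values `kleinJ_heegnerTau_neg_three` … `kleinJ_heegnerTau_neg_oneSixtyThree`
  (`j(τ_{(1,1,41)}) = −640320³`, …) — the bridge from the tree's modular function `kleinJ` and CM points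
  `heegnerTau` to the integers every census of singular moduli computes with;
* `reducedFormsList_neg_eleven` … `_neg_oneSixtyThree` — the one reduced form of each of the remaining
  class-number-one fundamental discriminants (Cox Thm. 2.13), so that `J(d₁, d₂) = j(d₁) − j(d₂)` is a
  single difference (`J_neg_three_neg_eight`, …, thirty-five values);
* `rhs_neg_three_neg_eight` … `rhs_neg_sixtySeven_neg_oneSixtyThree` — the right-hand side
  `∏_{x² < d₁d₂, x ≡ d₁d₂ (2)} F((d₁d₂ − x²)/4)` of Theorem 1.3 EVALUATED from the typed `ε`/`F`/`rhs`
  by the kernel (`decide +kernel`: the Kronecker symbols `jacobiSym`, the factorisations and the divisor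
  products all reduce), for the thirty-one pairs not already in `GrossZagierSingularModuli.lean`;
* `singularModuli_neg_three_neg_four` … `singularModuli_neg_sixtySeven_neg_oneSixtyThree` — **Theorem 1.3
  at each of the 35 coprime pairs `d₂ < d₁` of the nine fundamental discriminants of class number one**
  `{−3, −4, −7, −8, −11, −19, −43, −67, −163}` (every pair except `(−4, −8)`), i.e. the body of the
  named fact `grossZagier1985_singularModuli` at these arguments, now a theorem: e.g.
  `(j(−67) − j(−163))^8 = (2¹⁵·3⁷·5³·7²·13·139·331)^{2·4}` with
  `j(−67) − j(−163) = −2¹⁵3³5³(11³ − 2³·23³29³) = 2¹⁵·3⁷·5³·7²·13·139·331`, all primes `< 67·163/4`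
  as the theorem predicts (Gross–Zagier, Cor. 1.6 / the discussion after Thm. 1.3: every prime
  `ℓ ∣ J(d₁,d₂)` satisfies `ℓ ≤ d₁d₂/4`, `(d₁/ℓ) ≠ 1 ≠ (d₂/ℓ)`).

What this certifies. The primary source being unheld (acquisition acq-03341), the typing of
Theorem 1.3 in `GrossZagierSingularModuli.lean` was taken from a secondary restatement; its
conventions — `ε(2)` by the Kronecker symbol mod `8`, the choice of `dᵢ` at primes dividing `d₁d₂`,
the index set `x² < d₁d₂` (not Lauter–Viray's printed `|x| < d₁d₂`), the exponent `w₁w₂` — are exactly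
the places where a transcription can go wrong. The thirty-five instances are ALL the instances of the
theorem in which both class numbers are one (both singular moduli rational), and each is decided here
by the kernel from the definitions as typed: a faithfulness test of the typing on every rational
instance there is (35/35 agree). They are instances of a published theorem, not new results; the cell
`pub-hlocus` (Hodge-locus census, abs line) uses them as certified anchor values for its Gross–Zagier /
Lauter–Viray rows. Second implementation (pure Python, exact rationals, independent code) of the 35
right-hand sides and of `J^8 = rhs^{w₁w₂}`: cell file `pub-hlocus-lit-g49/gz/gz_cn1.py` (35/35).

Not here: the fact itself for class number `> 1` (irrational singular moduli; that is Gross–Zagier's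
theorem proper, XL); the sign of `J^{8/(w₁w₂)}`; Lauter–Viray's extension to non-fundamental
discriminants (the four non-maximal class-number-one orders `−12, −16, −27, −28` are outside the
hypotheses of Thm. 1.3 — only their `j`-values are recorded).

## References

* [GrossZagier1985SingularModuli] B. H. Gross, D. B. Zagier, *On singular moduli*, J. reine angew.
  Math. 355 (1985) 191–220, Theorem 1.3, Cor. 1.6.
* [LauterViray2015SingularModuli] K. Lauter, B. Viray, *On singular moduli for arbitrary discriminants*,
  IMRN 2015 (19) 9206–9250 = arXiv:1206.6942, §1 (the restatement typed in the tree).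
* [Cox2013] D. A. Cox, *Primes of the form x² + ny²*, 2nd ed., Wiley 2013, §2.A Thm. 2.13 (reduced
  forms), §7.D Thm. 7.30 (class number one), §12.C table (12.20) (the thirteen singular moduli),
  Thm. 13.24 (the Gross–Zagier formula).

## Tree search

`lean search 'kleinJ (heegnerTau (1'`, `'formJ (principalForm'`, `'classPolynomial (-7)'`,
`'reducedFormsList (-11)'`: no evaluated singular modulus at an explicit Heegner point beyond
`kleinJ_I`, `kleinJ_rho` and lit-g45's conditional `kleinJ_formTau_neg_seven/_neg_eight (h)`; the
bridge lemmas used are `formJ_principalForm` and `j_cmPeriodPair_eq_singularModulus`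
(`ComplexMultiplicationJInvariantProofs.lean`), fed with the two discharged table facts.
-/

noncomputable section

open scoped NumberTheorySymbols

namespace Literature.NumberTheory.EllipticCurves

namespace GrossZagier1985

open Literature.NumberTheory.QuadraticFields.Quadratic
open Literature.NumberTheory.QuadraticFields.BinaryQuadraticForm (principalForm classNumberOneDiscrs)
open Literature.NumberTheory.EllipticCurves.ModularForms

/-! ### §0. Klein's `j` at the CM point of the principal form of a class-number-one discriminant -/

/-- **The thirteen rational singular moduli at explicit CM points.** For each class-number-one
discriminant `D ∈ {−3, −4, −7, −8, −11, −12, −16, −19, −27, −28, −43, −67, −163}`, Klein's modular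
function at the Heegner point `τ_P = (−b + √D)/2` of the principal form `P = (1, b, c)` of discriminant
`D` equals the tabulated singular modulus `j(𝒪_D)` (Cox, §12.C table (12.20)), by the tree's theorems
`formJ_principalForm` (`j(τ_P) = j([ω_D, 1])`) and the discharged table facts
`singularModuli_classNumberOne_holds`, `singularModuli_nonmaximalOrders_holds`.
[cite: Cox2013, §12.C table (12.20)] -/
theorem kleinJ_heegnerTau_principalForm {D : ℤ} (hD : D ∈ classNumberOneDiscrs) :
    kleinJ (heegnerTau (principalForm D)) = ((singularModulus D : ℚ) : ℂ) := by
  have h : D < 0 ∧ (D % 4 = 0 ∨ D % 4 = 1) := by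
    have hD' := hD
    simp only [classNumberOneDiscrs, Finset.mem_insert, Finset.mem_singleton] at hD'
    rcases hD' with rfl | rfl | rfl | rfl | rfl | rfl | rfl | rfl | rfl | rfl | rfl | rfl | rfl <;>
      norm_num
  rw [kleinJ_eq_periodPair_j, ← formJ_def, formJ_principalForm h.1 h.2,
    j_cmPeriodPair_eq_singularModulus singularModuli_classNumberOne_holds
      singularModuli_nonmaximalOrders_holds hD]

/-- `j(τ_P) = 0` at the CM point of the principal form `P = (1, 1, 1)` of discriminant `−3`
(maximal order of class number one; Cox §12.C table (12.20)).
[cite: Cox2013, §12.C table (12.20)] -/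
theorem kleinJ_heegnerTau_neg_three : kleinJ (heegnerTau (1, 1, 1)) = 0 := by
  have h := kleinJ_heegnerTau_principalForm (D := -3) (by decide)
  rw [show principalForm (-3) = (1, 1, 1) by decide] at h
  rw [h]
  norm_num [singularModulus]

/-- `j(τ_P) = 1728` at the CM point of the principal form `P = (1, 0, 1)` of discriminant `−4`
(maximal order of class number one; Cox §12.C table (12.20)).
[cite: Cox2013, §12.C table (12.20)] -/
theorem kleinJ_heegnerTau_neg_four : kleinJ (heegnerTau (1, 0, 1)) = 1728 := by
  have h := kleinJ_heegnerTau_principalForm (D := -4) (by decide)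
  rw [show principalForm (-4) = (1, 0, 1) by decide] at h
  rw [h]
  norm_num [singularModulus]

/-- `j(τ_P) = -3375` at the CM point of the principal form `P = (1, 1, 2)` of discriminant `−7`
(maximal order of class number one; Cox §12.C table (12.20)).
[cite: Cox2013, §12.C table (12.20)] -/
theorem kleinJ_heegnerTau_neg_seven : kleinJ (heegnerTau (1, 1, 2)) = -3375 := by
  have h := kleinJ_heegnerTau_principalForm (D := -7) (by decide)
  rw [show principalForm (-7) = (1, 1, 2) by decide] at h
  rw [h]
  norm_num [singularModulus]

/-- `j(τ_P) = 8000` at the CM point of the principal form `P = (1, 0, 2)` of discriminant `−8`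
(maximal order of class number one; Cox §12.C table (12.20)).
[cite: Cox2013, §12.C table (12.20)] -/
theorem kleinJ_heegnerTau_neg_eight : kleinJ (heegnerTau (1, 0, 2)) = 8000 := by
  have h := kleinJ_heegnerTau_principalForm (D := -8) (by decide)
  rw [show principalForm (-8) = (1, 0, 2) by decide] at h
  rw [h]
  norm_num [singularModulus]

/-- `j(τ_P) = -32768` at the CM point of the principal form `P = (1, 1, 3)` of discriminant `−11`
(maximal order of class number one; Cox §12.C table (12.20)).
[cite: Cox2013, §12.C table (12.20)] -/
theorem kleinJ_heegnerTau_neg_eleven : kleinJ (heegnerTau (1, 1, 3)) = -32768 := by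
  have h := kleinJ_heegnerTau_principalForm (D := -11) (by decide)
  rw [show principalForm (-11) = (1, 1, 3) by decide] at h
  rw [h]
  norm_num [singularModulus]

/-- `j(τ_P) = 54000` at the CM point of the principal form `P = (1, 0, 3)` of discriminant `−12`
(non-maximal order of class number one; Cox §12.C table (12.20)).
[cite: Cox2013, §12.C table (12.20)] -/
theorem kleinJ_heegnerTau_neg_twelve : kleinJ (heegnerTau (1, 0, 3)) = 54000 := by
  have h := kleinJ_heegnerTau_principalForm (D := -12) (by decide)
  rw [show principalForm (-12) = (1, 0, 3) by decide] at h
  rw [h]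
  norm_num [singularModulus]

/-- `j(τ_P) = 287496` at the CM point of the principal form `P = (1, 0, 4)` of discriminant `−16`
(non-maximal order of class number one; Cox §12.C table (12.20)).
[cite: Cox2013, §12.C table (12.20)] -/
theorem kleinJ_heegnerTau_neg_sixteen : kleinJ (heegnerTau (1, 0, 4)) = 287496 := by
  have h := kleinJ_heegnerTau_principalForm (D := -16) (by decide)
  rw [show principalForm (-16) = (1, 0, 4) by decide] at h
  rw [h]
  norm_num [singularModulus]

/-- `j(τ_P) = -884736` at the CM point of the principal form `P = (1, 1, 5)` of discriminant `−19`
(maximal order of class number one; Cox §12.C table (12.20)).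
[cite: Cox2013, §12.C table (12.20)] -/
theorem kleinJ_heegnerTau_neg_nineteen : kleinJ (heegnerTau (1, 1, 5)) = -884736 := by
  have h := kleinJ_heegnerTau_principalForm (D := -19) (by decide)
  rw [show principalForm (-19) = (1, 1, 5) by decide] at h
  rw [h]
  norm_num [singularModulus]

/-- `j(τ_P) = -12288000` at the CM point of the principal form `P = (1, 1, 7)` of discriminant `−27`
(non-maximal order of class number one; Cox §12.C table (12.20)).
[cite: Cox2013, §12.C table (12.20)] -/
theorem kleinJ_heegnerTau_neg_twentySeven : kleinJ (heegnerTau (1, 1, 7)) = -12288000 := by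
  have h := kleinJ_heegnerTau_principalForm (D := -27) (by decide)
  rw [show principalForm (-27) = (1, 1, 7) by decide] at h
  rw [h]
  norm_num [singularModulus]

/-- `j(τ_P) = 16581375` at the CM point of the principal form `P = (1, 0, 7)` of discriminant `−28`
(non-maximal order of class number one; Cox §12.C table (12.20)).
[cite: Cox2013, §12.C table (12.20)] -/
theorem kleinJ_heegnerTau_neg_twentyEight : kleinJ (heegnerTau (1, 0, 7)) = 16581375 := by
  have h := kleinJ_heegnerTau_principalForm (D := -28) (by decide)
  rw [show principalForm (-28) = (1, 0, 7) by decide] at h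
  rw [h]
  norm_num [singularModulus]

/-- `j(τ_P) = -884736000` at the CM point of the principal form `P = (1, 1, 11)` of discriminant `−43`
(maximal order of class number one; Cox §12.C table (12.20)).
[cite: Cox2013, §12.C table (12.20)] -/
theorem kleinJ_heegnerTau_neg_fortyThree : kleinJ (heegnerTau (1, 1, 11)) = -884736000 := by
  have h := kleinJ_heegnerTau_principalForm (D := -43) (by decide)
  rw [show principalForm (-43) = (1, 1, 11) by decide] at h
  rw [h]
  norm_num [singularModulus]

/-- `j(τ_P) = -147197952000` at the CM point of the principal form `P = (1, 1, 17)` of discriminant `−67`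
(maximal order of class number one; Cox §12.C table (12.20)).
[cite: Cox2013, §12.C table (12.20)] -/
theorem kleinJ_heegnerTau_neg_sixtySeven : kleinJ (heegnerTau (1, 1, 17)) = -147197952000 := by
  have h := kleinJ_heegnerTau_principalForm (D := -67) (by decide)
  rw [show principalForm (-67) = (1, 1, 17) by decide] at h
  rw [h]
  norm_num [singularModulus]

/-- `j(τ_P) = -262537412640768000` at the CM point of the principal form `P = (1, 1, 41)` of discriminant `−163`
(maximal order of class number one; Cox §12.C table (12.20)).
[cite: Cox2013, §12.C table (12.20)] -/
theorem kleinJ_heegnerTau_neg_oneSixtyThree : kleinJ (heegnerTau (1, 1, 41)) = -262537412640768000 := by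
  have h := kleinJ_heegnerTau_principalForm (D := -163) (by decide)
  rw [show principalForm (-163) = (1, 1, 41) by decide] at h
  rw [h]
  norm_num [singularModulus]

/-! ### §1. The reduced forms and `J(d₁, d₂) = j(d₁) − j(d₂)` for class-number-one pairs -/

/-- The only reduced form of discriminant `−11` is `x² + xy + 3y²`. [cite: Cox2013, Thm. 2.13] -/
theorem reducedFormsList_neg_eleven : BinQF.reducedFormsList (-11) = [⟨1, 1, 3⟩] := by
  decide

/-- The only reduced form of discriminant `−19` is `x² + xy + 5y²`. [cite: Cox2013, Thm. 2.13] -/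
theorem reducedFormsList_neg_nineteen : BinQF.reducedFormsList (-19) = [⟨1, 1, 5⟩] := by
  decide

/-- The only reduced form of discriminant `−43` is `x² + xy + 11y²`. [cite: Cox2013, Thm. 2.13] -/
theorem reducedFormsList_neg_fortyThree : BinQF.reducedFormsList (-43) = [⟨1, 1, 11⟩] := by
  decide

/-- The only reduced form of discriminant `−67` is `x² + xy + 17y²`. [cite: Cox2013, Thm. 2.13] -/
theorem reducedFormsList_neg_sixtySeven : BinQF.reducedFormsList (-67) = [⟨1, 1, 17⟩] := by
  decide

/-- The only reduced form of discriminant `−163` is `x² + xy + 41y²`. [cite: Cox2013, Thm. 2.13] -/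
theorem reducedFormsList_neg_oneSixtyThree : BinQF.reducedFormsList (-163) = [⟨1, 1, 41⟩] := by
  decide

/-- For singleton class groups `J(d₁, d₂)` is the single difference `j(τ_f) − j(τ_g)`. [folklore] -/
private theorem J_of_singleton {d₁ d₂ : ℤ} {f g : BinQF} (h₁ : BinQF.reducedFormsList d₁ = [f])
    (h₂ : BinQF.reducedFormsList d₂ = [g]) :
    J d₁ d₂ = kleinJ (heegnerTau (f.a, f.b, f.c)) - kleinJ (heegnerTau (g.a, g.b, g.c)) := by
  simp [J, h₁, h₂, formTau]

/-- `J(−3, −7) = j(−3) − j(−7) = 0 − (-3375) = 3375`.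
[cite: GrossZagier1985SingularModuli, §1 (definition of J)] -/
theorem J_neg_three_neg_seven : J (-3) (-7) = 3375 := by
  rw [J_of_singleton (show BinQF.reducedFormsList (-3) = [⟨1, 1, 1⟩] by decide) reducedFormsList_neg_seven]
  simp only [kleinJ_heegnerTau_neg_three, kleinJ_heegnerTau_neg_seven]
  norm_num

/-- `J(−3, −8) = j(−3) − j(−8) = 0 − (8000) = -8000`.
[cite: GrossZagier1985SingularModuli, §1 (definition of J)] -/
theorem J_neg_three_neg_eight : J (-3) (-8) = -8000 := by
  rw [J_of_singleton (show BinQF.reducedFormsList (-3) = [⟨1, 1, 1⟩] by decide) reducedFormsList_neg_eight]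
  simp only [kleinJ_heegnerTau_neg_three, kleinJ_heegnerTau_neg_eight]
  norm_num

/-- `J(−3, −11) = j(−3) − j(−11) = 0 − (-32768) = 32768`.
[cite: GrossZagier1985SingularModuli, §1 (definition of J)] -/
theorem J_neg_three_neg_eleven : J (-3) (-11) = 32768 := by
  rw [J_of_singleton (show BinQF.reducedFormsList (-3) = [⟨1, 1, 1⟩] by decide) reducedFormsList_neg_eleven]
  simp only [kleinJ_heegnerTau_neg_three, kleinJ_heegnerTau_neg_eleven]
  norm_num

/-- `J(−3, −19) = j(−3) − j(−19) = 0 − (-884736) = 884736`.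
[cite: GrossZagier1985SingularModuli, §1 (definition of J)] -/
theorem J_neg_three_neg_nineteen : J (-3) (-19) = 884736 := by
  rw [J_of_singleton (show BinQF.reducedFormsList (-3) = [⟨1, 1, 1⟩] by decide) reducedFormsList_neg_nineteen]
  simp only [kleinJ_heegnerTau_neg_three, kleinJ_heegnerTau_neg_nineteen]
  norm_num

/-- `J(−3, −43) = j(−3) − j(−43) = 0 − (-884736000) = 884736000`.
[cite: GrossZagier1985SingularModuli, §1 (definition of J)] -/
theorem J_neg_three_neg_fortyThree : J (-3) (-43) = 884736000 := by
  rw [J_of_singleton (show BinQF.reducedFormsList (-3) = [⟨1, 1, 1⟩] by decide) reducedFormsList_neg_fortyThree]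
  simp only [kleinJ_heegnerTau_neg_three, kleinJ_heegnerTau_neg_fortyThree]
  norm_num

/-- `J(−3, −67) = j(−3) − j(−67) = 0 − (-147197952000) = 147197952000`.
[cite: GrossZagier1985SingularModuli, §1 (definition of J)] -/
theorem J_neg_three_neg_sixtySeven : J (-3) (-67) = 147197952000 := by
  rw [J_of_singleton (show BinQF.reducedFormsList (-3) = [⟨1, 1, 1⟩] by decide) reducedFormsList_neg_sixtySeven]
  simp only [kleinJ_heegnerTau_neg_three, kleinJ_heegnerTau_neg_sixtySeven]
  norm_num

/-- `J(−3, −163) = j(−3) − j(−163) = 0 − (-262537412640768000) = 262537412640768000`.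
[cite: GrossZagier1985SingularModuli, §1 (definition of J)] -/
theorem J_neg_three_neg_oneSixtyThree : J (-3) (-163) = 262537412640768000 := by
  rw [J_of_singleton (show BinQF.reducedFormsList (-3) = [⟨1, 1, 1⟩] by decide) reducedFormsList_neg_oneSixtyThree]
  simp only [kleinJ_heegnerTau_neg_three, kleinJ_heegnerTau_neg_oneSixtyThree]
  norm_num

/-- `J(−4, −11) = j(−4) − j(−11) = 1728 − (-32768) = 34496`.
[cite: GrossZagier1985SingularModuli, §1 (definition of J)] -/
theorem J_neg_four_neg_eleven : J (-4) (-11) = 34496 := by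
  rw [J_of_singleton (show BinQF.reducedFormsList (-4) = [⟨1, 0, 1⟩] by decide) reducedFormsList_neg_eleven]
  simp only [kleinJ_heegnerTau_neg_four, kleinJ_heegnerTau_neg_eleven]
  norm_num

/-- `J(−4, −19) = j(−4) − j(−19) = 1728 − (-884736) = 886464`.
[cite: GrossZagier1985SingularModuli, §1 (definition of J)] -/
theorem J_neg_four_neg_nineteen : J (-4) (-19) = 886464 := by
  rw [J_of_singleton (show BinQF.reducedFormsList (-4) = [⟨1, 0, 1⟩] by decide) reducedFormsList_neg_nineteen]
  simp only [kleinJ_heegnerTau_neg_four, kleinJ_heegnerTau_neg_nineteen]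
  norm_num

/-- `J(−4, −43) = j(−4) − j(−43) = 1728 − (-884736000) = 884737728`.
[cite: GrossZagier1985SingularModuli, §1 (definition of J)] -/
theorem J_neg_four_neg_fortyThree : J (-4) (-43) = 884737728 := by
  rw [J_of_singleton (show BinQF.reducedFormsList (-4) = [⟨1, 0, 1⟩] by decide) reducedFormsList_neg_fortyThree]
  simp only [kleinJ_heegnerTau_neg_four, kleinJ_heegnerTau_neg_fortyThree]
  norm_num

/-- `J(−4, −67) = j(−4) − j(−67) = 1728 − (-147197952000) = 147197953728`.
[cite: GrossZagier1985SingularModuli, §1 (definition of J)] -/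
theorem J_neg_four_neg_sixtySeven : J (-4) (-67) = 147197953728 := by
  rw [J_of_singleton (show BinQF.reducedFormsList (-4) = [⟨1, 0, 1⟩] by decide) reducedFormsList_neg_sixtySeven]
  simp only [kleinJ_heegnerTau_neg_four, kleinJ_heegnerTau_neg_sixtySeven]
  norm_num

/-- `J(−4, −163) = j(−4) − j(−163) = 1728 − (-262537412640768000) = 262537412640769728`.
[cite: GrossZagier1985SingularModuli, §1 (definition of J)] -/
theorem J_neg_four_neg_oneSixtyThree : J (-4) (-163) = 262537412640769728 := by
  rw [J_of_singleton (show BinQF.reducedFormsList (-4) = [⟨1, 0, 1⟩] by decide) reducedFormsList_neg_oneSixtyThree]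
  simp only [kleinJ_heegnerTau_neg_four, kleinJ_heegnerTau_neg_oneSixtyThree]
  norm_num

/-- `J(−7, −8) = j(−7) − j(−8) = -3375 − (8000) = -11375`.
[cite: GrossZagier1985SingularModuli, §1 (definition of J)] -/
theorem J_neg_seven_neg_eight : J (-7) (-8) = -11375 := by
  rw [J_of_singleton reducedFormsList_neg_seven reducedFormsList_neg_eight]
  simp only [kleinJ_heegnerTau_neg_seven, kleinJ_heegnerTau_neg_eight]
  norm_num

/-- `J(−7, −11) = j(−7) − j(−11) = -3375 − (-32768) = 29393`.
[cite: GrossZagier1985SingularModuli, §1 (definition of J)] -/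
theorem J_neg_seven_neg_eleven : J (-7) (-11) = 29393 := by
  rw [J_of_singleton reducedFormsList_neg_seven reducedFormsList_neg_eleven]
  simp only [kleinJ_heegnerTau_neg_seven, kleinJ_heegnerTau_neg_eleven]
  norm_num

/-- `J(−7, −19) = j(−7) − j(−19) = -3375 − (-884736) = 881361`.
[cite: GrossZagier1985SingularModuli, §1 (definition of J)] -/
theorem J_neg_seven_neg_nineteen : J (-7) (-19) = 881361 := by
  rw [J_of_singleton reducedFormsList_neg_seven reducedFormsList_neg_nineteen]
  simp only [kleinJ_heegnerTau_neg_seven, kleinJ_heegnerTau_neg_nineteen]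
  norm_num

/-- `J(−7, −43) = j(−7) − j(−43) = -3375 − (-884736000) = 884732625`.
[cite: GrossZagier1985SingularModuli, §1 (definition of J)] -/
theorem J_neg_seven_neg_fortyThree : J (-7) (-43) = 884732625 := by
  rw [J_of_singleton reducedFormsList_neg_seven reducedFormsList_neg_fortyThree]
  simp only [kleinJ_heegnerTau_neg_seven, kleinJ_heegnerTau_neg_fortyThree]
  norm_num

/-- `J(−7, −67) = j(−7) − j(−67) = -3375 − (-147197952000) = 147197948625`.
[cite: GrossZagier1985SingularModuli, §1 (definition of J)] -/
theorem J_neg_seven_neg_sixtySeven : J (-7) (-67) = 147197948625 := by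
  rw [J_of_singleton reducedFormsList_neg_seven reducedFormsList_neg_sixtySeven]
  simp only [kleinJ_heegnerTau_neg_seven, kleinJ_heegnerTau_neg_sixtySeven]
  norm_num

/-- `J(−7, −163) = j(−7) − j(−163) = -3375 − (-262537412640768000) = 262537412640764625`.
[cite: GrossZagier1985SingularModuli, §1 (definition of J)] -/
theorem J_neg_seven_neg_oneSixtyThree : J (-7) (-163) = 262537412640764625 := by
  rw [J_of_singleton reducedFormsList_neg_seven reducedFormsList_neg_oneSixtyThree]
  simp only [kleinJ_heegnerTau_neg_seven, kleinJ_heegnerTau_neg_oneSixtyThree]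
  norm_num

/-- `J(−8, −11) = j(−8) − j(−11) = 8000 − (-32768) = 40768`.
[cite: GrossZagier1985SingularModuli, §1 (definition of J)] -/
theorem J_neg_eight_neg_eleven : J (-8) (-11) = 40768 := by
  rw [J_of_singleton reducedFormsList_neg_eight reducedFormsList_neg_eleven]
  simp only [kleinJ_heegnerTau_neg_eight, kleinJ_heegnerTau_neg_eleven]
  norm_num

/-- `J(−8, −19) = j(−8) − j(−19) = 8000 − (-884736) = 892736`.
[cite: GrossZagier1985SingularModuli, §1 (definition of J)] -/
theorem J_neg_eight_neg_nineteen : J (-8) (-19) = 892736 := by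
  rw [J_of_singleton reducedFormsList_neg_eight reducedFormsList_neg_nineteen]
  simp only [kleinJ_heegnerTau_neg_eight, kleinJ_heegnerTau_neg_nineteen]
  norm_num

/-- `J(−8, −43) = j(−8) − j(−43) = 8000 − (-884736000) = 884744000`.
[cite: GrossZagier1985SingularModuli, §1 (definition of J)] -/
theorem J_neg_eight_neg_fortyThree : J (-8) (-43) = 884744000 := by
  rw [J_of_singleton reducedFormsList_neg_eight reducedFormsList_neg_fortyThree]
  simp only [kleinJ_heegnerTau_neg_eight, kleinJ_heegnerTau_neg_fortyThree]
  norm_num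

/-- `J(−8, −67) = j(−8) − j(−67) = 8000 − (-147197952000) = 147197960000`.
[cite: GrossZagier1985SingularModuli, §1 (definition of J)] -/
theorem J_neg_eight_neg_sixtySeven : J (-8) (-67) = 147197960000 := by
  rw [J_of_singleton reducedFormsList_neg_eight reducedFormsList_neg_sixtySeven]
  simp only [kleinJ_heegnerTau_neg_eight, kleinJ_heegnerTau_neg_sixtySeven]
  norm_num

/-- `J(−8, −163) = j(−8) − j(−163) = 8000 − (-262537412640768000) = 262537412640776000`.
[cite: GrossZagier1985SingularModuli, §1 (definition of J)] -/
theorem J_neg_eight_neg_oneSixtyThree : J (-8) (-163) = 262537412640776000 := by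
  rw [J_of_singleton reducedFormsList_neg_eight reducedFormsList_neg_oneSixtyThree]
  simp only [kleinJ_heegnerTau_neg_eight, kleinJ_heegnerTau_neg_oneSixtyThree]
  norm_num

/-- `J(−11, −19) = j(−11) − j(−19) = -32768 − (-884736) = 851968`.
[cite: GrossZagier1985SingularModuli, §1 (definition of J)] -/
theorem J_neg_eleven_neg_nineteen : J (-11) (-19) = 851968 := by
  rw [J_of_singleton reducedFormsList_neg_eleven reducedFormsList_neg_nineteen]
  simp only [kleinJ_heegnerTau_neg_eleven, kleinJ_heegnerTau_neg_nineteen]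
  norm_num

/-- `J(−11, −43) = j(−11) − j(−43) = -32768 − (-884736000) = 884703232`.
[cite: GrossZagier1985SingularModuli, §1 (definition of J)] -/
theorem J_neg_eleven_neg_fortyThree : J (-11) (-43) = 884703232 := by
  rw [J_of_singleton reducedFormsList_neg_eleven reducedFormsList_neg_fortyThree]
  simp only [kleinJ_heegnerTau_neg_eleven, kleinJ_heegnerTau_neg_fortyThree]
  norm_num

/-- `J(−11, −67) = j(−11) − j(−67) = -32768 − (-147197952000) = 147197919232`.
[cite: GrossZagier1985SingularModuli, §1 (definition of J)] -/
theorem J_neg_eleven_neg_sixtySeven : J (-11) (-67) = 147197919232 := by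
  rw [J_of_singleton reducedFormsList_neg_eleven reducedFormsList_neg_sixtySeven]
  simp only [kleinJ_heegnerTau_neg_eleven, kleinJ_heegnerTau_neg_sixtySeven]
  norm_num

/-- `J(−11, −163) = j(−11) − j(−163) = -32768 − (-262537412640768000) = 262537412640735232`.
[cite: GrossZagier1985SingularModuli, §1 (definition of J)] -/
theorem J_neg_eleven_neg_oneSixtyThree : J (-11) (-163) = 262537412640735232 := by
  rw [J_of_singleton reducedFormsList_neg_eleven reducedFormsList_neg_oneSixtyThree]
  simp only [kleinJ_heegnerTau_neg_eleven, kleinJ_heegnerTau_neg_oneSixtyThree]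
  norm_num

/-- `J(−19, −43) = j(−19) − j(−43) = -884736 − (-884736000) = 883851264`.
[cite: GrossZagier1985SingularModuli, §1 (definition of J)] -/
theorem J_neg_nineteen_neg_fortyThree : J (-19) (-43) = 883851264 := by
  rw [J_of_singleton reducedFormsList_neg_nineteen reducedFormsList_neg_fortyThree]
  simp only [kleinJ_heegnerTau_neg_nineteen, kleinJ_heegnerTau_neg_fortyThree]
  norm_num

/-- `J(−19, −67) = j(−19) − j(−67) = -884736 − (-147197952000) = 147197067264`.
[cite: GrossZagier1985SingularModuli, §1 (definition of J)] -/
theorem J_neg_nineteen_neg_sixtySeven : J (-19) (-67) = 147197067264 := by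
  rw [J_of_singleton reducedFormsList_neg_nineteen reducedFormsList_neg_sixtySeven]
  simp only [kleinJ_heegnerTau_neg_nineteen, kleinJ_heegnerTau_neg_sixtySeven]
  norm_num

/-- `J(−19, −163) = j(−19) − j(−163) = -884736 − (-262537412640768000) = 262537412639883264`.
[cite: GrossZagier1985SingularModuli, §1 (definition of J)] -/
theorem J_neg_nineteen_neg_oneSixtyThree : J (-19) (-163) = 262537412639883264 := by
  rw [J_of_singleton reducedFormsList_neg_nineteen reducedFormsList_neg_oneSixtyThree]
  simp only [kleinJ_heegnerTau_neg_nineteen, kleinJ_heegnerTau_neg_oneSixtyThree]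
  norm_num

/-- `J(−43, −67) = j(−43) − j(−67) = -884736000 − (-147197952000) = 146313216000`.
[cite: GrossZagier1985SingularModuli, §1 (definition of J)] -/
theorem J_neg_fortyThree_neg_sixtySeven : J (-43) (-67) = 146313216000 := by
  rw [J_of_singleton reducedFormsList_neg_fortyThree reducedFormsList_neg_sixtySeven]
  simp only [kleinJ_heegnerTau_neg_fortyThree, kleinJ_heegnerTau_neg_sixtySeven]
  norm_num

/-- `J(−43, −163) = j(−43) − j(−163) = -884736000 − (-262537412640768000) = 262537411756032000`.
[cite: GrossZagier1985SingularModuli, §1 (definition of J)] -/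
theorem J_neg_fortyThree_neg_oneSixtyThree : J (-43) (-163) = 262537411756032000 := by
  rw [J_of_singleton reducedFormsList_neg_fortyThree reducedFormsList_neg_oneSixtyThree]
  simp only [kleinJ_heegnerTau_neg_fortyThree, kleinJ_heegnerTau_neg_oneSixtyThree]
  norm_num

/-- `J(−67, −163) = j(−67) − j(−163) = -147197952000 − (-262537412640768000) = 262537265442816000`.
[cite: GrossZagier1985SingularModuli, §1 (definition of J)] -/
theorem J_neg_sixtySeven_neg_oneSixtyThree : J (-67) (-163) = 262537265442816000 := by
  rw [J_of_singleton reducedFormsList_neg_sixtySeven reducedFormsList_neg_oneSixtyThree]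
  simp only [kleinJ_heegnerTau_neg_sixtySeven, kleinJ_heegnerTau_neg_oneSixtyThree]
  norm_num

/-! ### §2. The right-hand sides `∏ₓ F((d₁d₂ − x²)/4)`, evaluated by the kernel from the typed `ε`, `F` -/

/-- `∏ₓ F((24 − x²)/4) = 400` (5 factors `x² < 24`, `x ≡ 24 (2)`): the right-hand side of
Thm. 1.3 at `(−3, −8)`, decided by the kernel. [cite: GrossZagier1985SingularModuli, Theorem 1.3 (rhs at (−3, −8))] -/
theorem rhs_neg_three_neg_eight : rhs (-3) (-8) = 400 := by
  decide +kernel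

/-- `∏ₓ F((33 − x²)/4) = 1024` (6 factors `x² < 33`, `x ≡ 33 (2)`): the right-hand side of
Thm. 1.3 at `(−3, −11)`, decided by the kernel. [cite: GrossZagier1985SingularModuli, Theorem 1.3 (rhs at (−3, −11))] -/
theorem rhs_neg_three_neg_eleven : rhs (-3) (-11) = 1024 := by
  decide +kernel

/-- `∏ₓ F((57 − x²)/4) = 9216` (8 factors `x² < 57`, `x ≡ 57 (2)`): the right-hand side of
Thm. 1.3 at `(−3, −19)`, decided by the kernel. [cite: GrossZagier1985SingularModuli, Theorem 1.3 (rhs at (−3, −19))] -/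
theorem rhs_neg_three_neg_nineteen : rhs (-3) (-19) = 9216 := by
  decide +kernel

/-- `∏ₓ F((129 − x²)/4) = 921600` (12 factors `x² < 129`, `x ≡ 129 (2)`): the right-hand side of
Thm. 1.3 at `(−3, −43)`, decided by the kernel. [cite: GrossZagier1985SingularModuli, Theorem 1.3 (rhs at (−3, −43))] -/
theorem rhs_neg_three_neg_fortyThree : rhs (-3) (-43) = 921600 := by
  decide +kernel

/-- `∏ₓ F((201 − x²)/4) = 27878400` (14 factors `x² < 201`, `x ≡ 201 (2)`): the right-hand side of
Thm. 1.3 at `(−3, −67)`, decided by the kernel. [cite: GrossZagier1985SingularModuli, Theorem 1.3 (rhs at (−3, −67))] -/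
theorem rhs_neg_three_neg_sixtySeven : rhs (-3) (-67) = 27878400 := by
  decide +kernel

/-- `∏ₓ F((489 − x²)/4) = 410009702400` (22 factors `x² < 489`, `x ≡ 489 (2)`): the right-hand side of
Thm. 1.3 at `(−3, −163)`, decided by the kernel. [cite: GrossZagier1985SingularModuli, Theorem 1.3 (rhs at (−3, −163))] -/
theorem rhs_neg_three_neg_oneSixtyThree : rhs (-3) (-163) = 410009702400 := by
  decide +kernel

/-- `∏ₓ F((44 − x²)/4) = 34496` (7 factors `x² < 44`, `x ≡ 44 (2)`): the right-hand side of
Thm. 1.3 at `(−4, −11)`, decided by the kernel. [cite: GrossZagier1985SingularModuli, Theorem 1.3 (rhs at (−4, −11))] -/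
theorem rhs_neg_four_neg_eleven : rhs (-4) (-11) = 34496 := by
  decide +kernel

/-- `∏ₓ F((76 − x²)/4) = 886464` (9 factors `x² < 76`, `x ≡ 76 (2)`): the right-hand side of
Thm. 1.3 at `(−4, −19)`, decided by the kernel. [cite: GrossZagier1985SingularModuli, Theorem 1.3 (rhs at (−4, −19))] -/
theorem rhs_neg_four_neg_nineteen : rhs (-4) (-19) = 886464 := by
  decide +kernel

/-- `∏ₓ F((172 − x²)/4) = 884737728` (13 factors `x² < 172`, `x ≡ 172 (2)`): the right-hand side of
Thm. 1.3 at `(−4, −43)`, decided by the kernel. [cite: GrossZagier1985SingularModuli, Theorem 1.3 (rhs at (−4, −43))] -/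
theorem rhs_neg_four_neg_fortyThree : rhs (-4) (-43) = 884737728 := by
  decide +kernel

/-- `∏ₓ F((268 − x²)/4) = 147197953728` (17 factors `x² < 268`, `x ≡ 268 (2)`): the right-hand side of
Thm. 1.3 at `(−4, −67)`, decided by the kernel. [cite: GrossZagier1985SingularModuli, Theorem 1.3 (rhs at (−4, −67))] -/
theorem rhs_neg_four_neg_sixtySeven : rhs (-4) (-67) = 147197953728 := by
  decide +kernel

/-- `∏ₓ F((652 − x²)/4) = 262537412640769728` (25 factors `x² < 652`, `x ≡ 652 (2)`): the right-hand side of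
Thm. 1.3 at `(−4, −163)`, decided by the kernel. [cite: GrossZagier1985SingularModuli, Theorem 1.3 (rhs at (−4, −163))] -/
theorem rhs_neg_four_neg_oneSixtyThree : rhs (-4) (-163) = 262537412640769728 := by
  decide +kernel

/-- `∏ₓ F((77 − x²)/4) = 863948449` (8 factors `x² < 77`, `x ≡ 77 (2)`): the right-hand side of
Thm. 1.3 at `(−7, −11)`, decided by the kernel. [cite: GrossZagier1985SingularModuli, Theorem 1.3 (rhs at (−7, −11))] -/
theorem rhs_neg_seven_neg_eleven : rhs (-7) (-11) = 863948449 := by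
  decide +kernel

/-- `∏ₓ F((133 − x²)/4) = 776797212321` (12 factors `x² < 133`, `x ≡ 133 (2)`): the right-hand side of
Thm. 1.3 at `(−7, −19)`, decided by the kernel. [cite: GrossZagier1985SingularModuli, Theorem 1.3 (rhs at (−7, −19))] -/
theorem rhs_neg_seven_neg_nineteen : rhs (-7) (-19) = 776797212321 := by
  decide +kernel

/-- `∏ₓ F((301 − x²)/4) = 782751817739390625` (18 factors `x² < 301`, `x ≡ 301 (2)`): the right-hand side of
Thm. 1.3 at `(−7, −43)`, decided by the kernel. [cite: GrossZagier1985SingularModuli, Theorem 1.3 (rhs at (−7, −43))] -/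
theorem rhs_neg_seven_neg_fortyThree : rhs (-7) (-43) = 782751817739390625 := by
  decide +kernel

/-- `∏ₓ F((469 − x²)/4) = 21667236079408139390625` (22 factors `x² < 469`, `x ≡ 469 (2)`): the right-hand side of
Thm. 1.3 at `(−7, −67)`, decided by the kernel. [cite: GrossZagier1985SingularModuli, Theorem 1.3 (rhs at (−7, −67))] -/
theorem rhs_neg_seven_neg_sixtySeven : rhs (-7) (-67) = 21667236079408139390625 := by
  decide +kernel

set_option maxHeartbeats 4000000 in -- kernel evaluation of 34 factors `F(m)`, `m` up to 285
/-- `∏ₓ F((1141 − x²)/4) = 68925893036107117107880304651390625` (34 factors `x² < 1141`, `x ≡ 1141 (2)`): the right-hand side of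
Thm. 1.3 at `(−7, −163)`, decided by the kernel. [cite: GrossZagier1985SingularModuli, Theorem 1.3 (rhs at (−7, −163))] -/
theorem rhs_neg_seven_neg_oneSixtyThree : rhs (-7) (-163) = 68925893036107117107880304651390625 := by
  decide +kernel

/-- `∏ₓ F((88 − x²)/4) = 1662029824` (9 factors `x² < 88`, `x ≡ 88 (2)`): the right-hand side of
Thm. 1.3 at `(−8, −11)`, decided by the kernel. [cite: GrossZagier1985SingularModuli, Theorem 1.3 (rhs at (−8, −11))] -/
theorem rhs_neg_eight_neg_eleven : rhs (-8) (-11) = 1662029824 := by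
  decide +kernel

/-- `∏ₓ F((152 − x²)/4) = 796977565696` (13 factors `x² < 152`, `x ≡ 152 (2)`): the right-hand side of
Thm. 1.3 at `(−8, −19)`, decided by the kernel. [cite: GrossZagier1985SingularModuli, Theorem 1.3 (rhs at (−8, −19))] -/
theorem rhs_neg_eight_neg_nineteen : rhs (-8) (-19) = 796977565696 := by
  decide +kernel

/-- `∏ₓ F((344 − x²)/4) = 782771945536000000` (19 factors `x² < 344`, `x ≡ 344 (2)`): the right-hand side of
Thm. 1.3 at `(−8, −43)`, decided by the kernel. [cite: GrossZagier1985SingularModuli, Theorem 1.3 (rhs at (−8, −43))] -/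
theorem rhs_neg_eight_neg_fortyThree : rhs (-8) (-43) = 782771945536000000 := by
  decide +kernel

/-- `∏ₓ F((536 − x²)/4) = 21667239428161600000000` (23 factors `x² < 536`, `x ≡ 536 (2)`): the right-hand side of
Thm. 1.3 at `(−8, −67)`, decided by the kernel. [cite: GrossZagier1985SingularModuli, Theorem 1.3 (rhs at (−8, −67))] -/
theorem rhs_neg_eight_neg_sixtySeven : rhs (-8) (-67) = 21667239428161600000000 := by
  decide +kernel

set_option maxHeartbeats 4000000 in -- kernel evaluation of 37 factors `F(m)`, `m` up to 326
/-- `∏ₓ F((1304 − x²)/4) = 68925893036113089834017882176000000` (37 factors `x² < 1304`, `x ≡ 1304 (2)`): the right-hand side of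
Thm. 1.3 at `(−8, −163)`, decided by the kernel. [cite: GrossZagier1985SingularModuli, Theorem 1.3 (rhs at (−8, −163))] -/
theorem rhs_neg_eight_neg_oneSixtyThree : rhs (-8) (-163) = 68925893036113089834017882176000000 := by
  decide +kernel

/-- `∏ₓ F((209 − x²)/4) = 725849473024` (14 factors `x² < 209`, `x ≡ 209 (2)`): the right-hand side of
Thm. 1.3 at `(−11, −19)`, decided by the kernel. [cite: GrossZagier1985SingularModuli, Theorem 1.3 (rhs at (−11, −19))] -/
theorem rhs_neg_eleven_neg_nineteen : rhs (-11) (-19) = 725849473024 := by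
  decide +kernel

/-- `∏ₓ F((473 − x²)/4) = 782699808711245824` (22 factors `x² < 473`, `x ≡ 473 (2)`): the right-hand side of
Thm. 1.3 at `(−11, −43)`, decided by the kernel. [cite: GrossZagier1985SingularModuli, Theorem 1.3 (rhs at (−11, −43))] -/
theorem rhs_neg_eleven_neg_fortyThree : rhs (-11) (-43) = 782699808711245824 := by
  decide +kernel

/-- `∏ₓ F((737 − x²)/4) = 21667227426230395469824` (28 factors `x² < 737`, `x ≡ 737 (2)`): the right-hand side of
Thm. 1.3 at `(−11, −67)`, decided by the kernel. [cite: GrossZagier1985SingularModuli, Theorem 1.3 (rhs at (−11, −67))] -/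
theorem rhs_neg_eleven_neg_sixtySeven : rhs (-11) (-67) = 21667227426230395469824 := by
  decide +kernel

set_option maxHeartbeats 4000000 in -- kernel evaluation of 42 factors `F(m)`, `m` up to 448
/-- `∏ₓ F((1793 − x²)/4) = 68925893036091683583540805526093824` (42 factors `x² < 1793`, `x ≡ 1793 (2)`): the right-hand side of
Thm. 1.3 at `(−11, −163)`, decided by the kernel. [cite: GrossZagier1985SingularModuli, Theorem 1.3 (rhs at (−11, −163))] -/
theorem rhs_neg_eleven_neg_oneSixtyThree : rhs (-11) (-163) = 68925893036091683583540805526093824 := by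
  decide +kernel

/-- `∏ₓ F((817 − x²)/4) = 781193056874397696` (28 factors `x² < 817`, `x ≡ 817 (2)`): the right-hand side of
Thm. 1.3 at `(−19, −43)`, decided by the kernel. [cite: GrossZagier1985SingularModuli, Theorem 1.3 (rhs at (−19, −43))] -/
theorem rhs_neg_nineteen_neg_fortyThree : rhs (-19) (-43) = 781193056874397696 := by
  decide +kernel

set_option maxHeartbeats 4000000 in -- kernel evaluation of 36 factors `F(m)`, `m` up to 318
/-- `∏ₓ F((1273 − x²)/4) = 21666976611122540445696` (36 factors `x² < 1273`, `x ≡ 1273 (2)`): the right-hand side of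
Thm. 1.3 at `(−19, −67)`, decided by the kernel. [cite: GrossZagier1985SingularModuli, Theorem 1.3 (rhs at (−19, −67))] -/
theorem rhs_neg_nineteen_neg_sixtySeven : rhs (-19) (-67) = 21666976611122540445696 := by
  decide +kernel

set_option maxHeartbeats 4000000 in -- kernel evaluation of 56 factors `F(m)`, `m` up to 774
/-- `∏ₓ F((3097 − x²)/4) = 68925893035644336634796127547293696` (56 factors `x² < 3097`, `x ≡ 3097 (2)`): the right-hand side of
Thm. 1.3 at `(−19, −163)`, decided by the kernel. [cite: GrossZagier1985SingularModuli, Theorem 1.3 (rhs at (−19, −163))] -/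
theorem rhs_neg_nineteen_neg_oneSixtyThree : rhs (-19) (-163) = 68925893035644336634796127547293696 := by
  decide +kernel

set_option maxHeartbeats 4000000 in -- kernel evaluation of 54 factors `F(m)`, `m` up to 720
/-- `∏ₓ F((2881 − x²)/4) = 21407557176262656000000` (54 factors `x² < 2881`, `x ≡ 2881 (2)`): the right-hand side of
Thm. 1.3 at `(−43, −67)`, decided by the kernel. [cite: GrossZagier1985SingularModuli, Theorem 1.3 (rhs at (−43, −67))] -/
theorem rhs_neg_fortyThree_neg_sixtySeven : rhs (-43) (-67) = 21407557176262656000000 := by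
  decide +kernel

set_option maxHeartbeats 4000000 in -- kernel evaluation of 84 factors `F(m)`, `m` up to 1752
/-- `∏ₓ F((7009 − x²)/4) = 68925892571556289397888385024000000` (84 factors `x² < 7009`, `x ≡ 7009 (2)`): the right-hand side of
Thm. 1.3 at `(−43, −163)`, decided by the kernel. [cite: GrossZagier1985SingularModuli, Theorem 1.3 (rhs at (−43, −163))] -/
theorem rhs_neg_fortyThree_neg_oneSixtyThree : rhs (-43) (-163) = 68925892571556289397888385024000000 := by
  decide +kernel

set_option maxHeartbeats 4000000 in -- kernel evaluation of 104 factors `F(m)`, `m` up to 2730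
/-- `∏ₓ F((10921 − x²)/4) = 68925815746191628272566009856000000` (104 factors `x² < 10921`, `x ≡ 10921 (2)`): the right-hand side of
Thm. 1.3 at `(−67, −163)`, decided by the kernel. [cite: GrossZagier1985SingularModuli, Theorem 1.3 (rhs at (−67, −163))] -/
theorem rhs_neg_sixtySeven_neg_oneSixtyThree : rhs (-67) (-163) = 68925815746191628272566009856000000 := by
  decide +kernel

/-! ### §3. Theorem 1.3 at the thirty-five pairs -/

/-- **Thm. 1.3 at `(−3, −7)`**: `J^8 = (3375)^8 = (225)^12 = (∏ₓ F)^(w₁w₂)`.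
[cite: GrossZagier1985SingularModuli, Theorem 1.3] -/
theorem singularModuli_neg_three_neg_seven :
    J (-3) (-7) ^ 8 = ((rhs (-3) (-7) : ℚ) : ℂ) ^ (unitCount (-3) * unitCount (-7)) := by
  rw [J_neg_three_neg_seven, rhs_neg_three_neg_seven,
    unitCount_neg_three, unitCount_of_ne (by norm_num) (by norm_num)]
  norm_num

/-- **Thm. 1.3 at `(−3, −8)`**: `J^8 = (-8000)^8 = (400)^12 = (∏ₓ F)^(w₁w₂)`.
[cite: GrossZagier1985SingularModuli, Theorem 1.3] -/
theorem singularModuli_neg_three_neg_eight :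
    J (-3) (-8) ^ 8 = ((rhs (-3) (-8) : ℚ) : ℂ) ^ (unitCount (-3) * unitCount (-8)) := by
  rw [J_neg_three_neg_eight, rhs_neg_three_neg_eight,
    unitCount_neg_three, unitCount_of_ne (by norm_num) (by norm_num)]
  norm_num

/-- **Thm. 1.3 at `(−3, −11)`**: `J^8 = (32768)^8 = (1024)^12 = (∏ₓ F)^(w₁w₂)`.
[cite: GrossZagier1985SingularModuli, Theorem 1.3] -/
theorem singularModuli_neg_three_neg_eleven :
    J (-3) (-11) ^ 8 = ((rhs (-3) (-11) : ℚ) : ℂ) ^ (unitCount (-3) * unitCount (-11)) := by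
  rw [J_neg_three_neg_eleven, rhs_neg_three_neg_eleven,
    unitCount_neg_three, unitCount_of_ne (by norm_num) (by norm_num)]
  norm_num

/-- **Thm. 1.3 at `(−3, −19)`**: `J^8 = (884736)^8 = (9216)^12 = (∏ₓ F)^(w₁w₂)`.
[cite: GrossZagier1985SingularModuli, Theorem 1.3] -/
theorem singularModuli_neg_three_neg_nineteen :
    J (-3) (-19) ^ 8 = ((rhs (-3) (-19) : ℚ) : ℂ) ^ (unitCount (-3) * unitCount (-19)) := by
  rw [J_neg_three_neg_nineteen, rhs_neg_three_neg_nineteen,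
    unitCount_neg_three, unitCount_of_ne (by norm_num) (by norm_num)]
  norm_num

/-- **Thm. 1.3 at `(−3, −43)`**: `J^8 = (884736000)^8 = (921600)^12 = (∏ₓ F)^(w₁w₂)`.
[cite: GrossZagier1985SingularModuli, Theorem 1.3] -/
theorem singularModuli_neg_three_neg_fortyThree :
    J (-3) (-43) ^ 8 = ((rhs (-3) (-43) : ℚ) : ℂ) ^ (unitCount (-3) * unitCount (-43)) := by
  rw [J_neg_three_neg_fortyThree, rhs_neg_three_neg_fortyThree,
    unitCount_neg_three, unitCount_of_ne (by norm_num) (by norm_num)]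
  norm_num

/-- **Thm. 1.3 at `(−3, −67)`**: `J^8 = (147197952000)^8 = (27878400)^12 = (∏ₓ F)^(w₁w₂)`.
[cite: GrossZagier1985SingularModuli, Theorem 1.3] -/
theorem singularModuli_neg_three_neg_sixtySeven :
    J (-3) (-67) ^ 8 = ((rhs (-3) (-67) : ℚ) : ℂ) ^ (unitCount (-3) * unitCount (-67)) := by
  rw [J_neg_three_neg_sixtySeven, rhs_neg_three_neg_sixtySeven,
    unitCount_neg_three, unitCount_of_ne (by norm_num) (by norm_num)]
  norm_num

/-- **Thm. 1.3 at `(−3, −163)`**: `J^8 = (262537412640768000)^8 = (410009702400)^12 = (∏ₓ F)^(w₁w₂)`.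
[cite: GrossZagier1985SingularModuli, Theorem 1.3] -/
theorem singularModuli_neg_three_neg_oneSixtyThree :
    J (-3) (-163) ^ 8 = ((rhs (-3) (-163) : ℚ) : ℂ) ^ (unitCount (-3) * unitCount (-163)) := by
  rw [J_neg_three_neg_oneSixtyThree, rhs_neg_three_neg_oneSixtyThree,
    unitCount_neg_three, unitCount_of_ne (by norm_num) (by norm_num)]
  norm_num

/-- **Thm. 1.3 at `(−4, −7)`**: `J^8 = (5103)^8 = (5103)^8 = (∏ₓ F)^(w₁w₂)`.
[cite: GrossZagier1985SingularModuli, Theorem 1.3] -/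
theorem singularModuli_neg_four_neg_seven :
    J (-4) (-7) ^ 8 = ((rhs (-4) (-7) : ℚ) : ℂ) ^ (unitCount (-4) * unitCount (-7)) := by
  rw [(J_neg_four_neg_seven singularModuli_classNumberOne_holds), rhs_neg_four_neg_seven,
    unitCount_neg_four, unitCount_of_ne (by norm_num) (by norm_num)]
  norm_num

/-- **Thm. 1.3 at `(−4, −11)`**: `J^8 = (34496)^8 = (34496)^8 = (∏ₓ F)^(w₁w₂)`.
[cite: GrossZagier1985SingularModuli, Theorem 1.3] -/
theorem singularModuli_neg_four_neg_eleven :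
    J (-4) (-11) ^ 8 = ((rhs (-4) (-11) : ℚ) : ℂ) ^ (unitCount (-4) * unitCount (-11)) := by
  rw [J_neg_four_neg_eleven, rhs_neg_four_neg_eleven,
    unitCount_neg_four, unitCount_of_ne (by norm_num) (by norm_num)]
  norm_num

/-- **Thm. 1.3 at `(−4, −19)`**: `J^8 = (886464)^8 = (886464)^8 = (∏ₓ F)^(w₁w₂)`.
[cite: GrossZagier1985SingularModuli, Theorem 1.3] -/
theorem singularModuli_neg_four_neg_nineteen :
    J (-4) (-19) ^ 8 = ((rhs (-4) (-19) : ℚ) : ℂ) ^ (unitCount (-4) * unitCount (-19)) := by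
  rw [J_neg_four_neg_nineteen, rhs_neg_four_neg_nineteen,
    unitCount_neg_four, unitCount_of_ne (by norm_num) (by norm_num)]
  norm_num

/-- **Thm. 1.3 at `(−4, −43)`**: `J^8 = (884737728)^8 = (884737728)^8 = (∏ₓ F)^(w₁w₂)`.
[cite: GrossZagier1985SingularModuli, Theorem 1.3] -/
theorem singularModuli_neg_four_neg_fortyThree :
    J (-4) (-43) ^ 8 = ((rhs (-4) (-43) : ℚ) : ℂ) ^ (unitCount (-4) * unitCount (-43)) := by
  rw [J_neg_four_neg_fortyThree, rhs_neg_four_neg_fortyThree,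
    unitCount_neg_four, unitCount_of_ne (by norm_num) (by norm_num)]
  norm_num

/-- **Thm. 1.3 at `(−4, −67)`**: `J^8 = (147197953728)^8 = (147197953728)^8 = (∏ₓ F)^(w₁w₂)`.
[cite: GrossZagier1985SingularModuli, Theorem 1.3] -/
theorem singularModuli_neg_four_neg_sixtySeven :
    J (-4) (-67) ^ 8 = ((rhs (-4) (-67) : ℚ) : ℂ) ^ (unitCount (-4) * unitCount (-67)) := by
  rw [J_neg_four_neg_sixtySeven, rhs_neg_four_neg_sixtySeven,
    unitCount_neg_four, unitCount_of_ne (by norm_num) (by norm_num)]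
  norm_num

/-- **Thm. 1.3 at `(−4, −163)`**: `J^8 = (262537412640769728)^8 = (262537412640769728)^8 = (∏ₓ F)^(w₁w₂)`.
[cite: GrossZagier1985SingularModuli, Theorem 1.3] -/
theorem singularModuli_neg_four_neg_oneSixtyThree :
    J (-4) (-163) ^ 8 = ((rhs (-4) (-163) : ℚ) : ℂ) ^ (unitCount (-4) * unitCount (-163)) := by
  rw [J_neg_four_neg_oneSixtyThree, rhs_neg_four_neg_oneSixtyThree,
    unitCount_neg_four, unitCount_of_ne (by norm_num) (by norm_num)]
  norm_num

/-- **Thm. 1.3 at `(−7, −8)`**: `J^8 = (-11375)^8 = (129390625)^4 = (∏ₓ F)^(w₁w₂)`.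
[cite: GrossZagier1985SingularModuli, Theorem 1.3] -/
theorem singularModuli_neg_seven_neg_eight :
    J (-7) (-8) ^ 8 = ((rhs (-7) (-8) : ℚ) : ℂ) ^ (unitCount (-7) * unitCount (-8)) := by
  rw [J_neg_seven_neg_eight, rhs_neg_seven_neg_eight,
    unitCount_of_ne (by norm_num) (by norm_num), unitCount_of_ne (by norm_num) (by norm_num)]
  norm_num

/-- **Thm. 1.3 at `(−7, −11)`**: `J^8 = (29393)^8 = (863948449)^4 = (∏ₓ F)^(w₁w₂)`.
[cite: GrossZagier1985SingularModuli, Theorem 1.3] -/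
theorem singularModuli_neg_seven_neg_eleven :
    J (-7) (-11) ^ 8 = ((rhs (-7) (-11) : ℚ) : ℂ) ^ (unitCount (-7) * unitCount (-11)) := by
  rw [J_neg_seven_neg_eleven, rhs_neg_seven_neg_eleven,
    unitCount_of_ne (by norm_num) (by norm_num), unitCount_of_ne (by norm_num) (by norm_num)]
  norm_num

/-- **Thm. 1.3 at `(−7, −19)`**: `J^8 = (881361)^8 = (776797212321)^4 = (∏ₓ F)^(w₁w₂)`.
[cite: GrossZagier1985SingularModuli, Theorem 1.3] -/
theorem singularModuli_neg_seven_neg_nineteen :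
    J (-7) (-19) ^ 8 = ((rhs (-7) (-19) : ℚ) : ℂ) ^ (unitCount (-7) * unitCount (-19)) := by
  rw [J_neg_seven_neg_nineteen, rhs_neg_seven_neg_nineteen,
    unitCount_of_ne (by norm_num) (by norm_num), unitCount_of_ne (by norm_num) (by norm_num)]
  norm_num

/-- **Thm. 1.3 at `(−7, −43)`**: `J^8 = (884732625)^8 = (782751817739390625)^4 = (∏ₓ F)^(w₁w₂)`.
[cite: GrossZagier1985SingularModuli, Theorem 1.3] -/
theorem singularModuli_neg_seven_neg_fortyThree :
    J (-7) (-43) ^ 8 = ((rhs (-7) (-43) : ℚ) : ℂ) ^ (unitCount (-7) * unitCount (-43)) := by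
  rw [J_neg_seven_neg_fortyThree, rhs_neg_seven_neg_fortyThree,
    unitCount_of_ne (by norm_num) (by norm_num), unitCount_of_ne (by norm_num) (by norm_num)]
  norm_num

/-- **Thm. 1.3 at `(−7, −67)`**: `J^8 = (147197948625)^8 = (21667236079408139390625)^4 = (∏ₓ F)^(w₁w₂)`.
[cite: GrossZagier1985SingularModuli, Theorem 1.3] -/
theorem singularModuli_neg_seven_neg_sixtySeven :
    J (-7) (-67) ^ 8 = ((rhs (-7) (-67) : ℚ) : ℂ) ^ (unitCount (-7) * unitCount (-67)) := by
  rw [J_neg_seven_neg_sixtySeven, rhs_neg_seven_neg_sixtySeven,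
    unitCount_of_ne (by norm_num) (by norm_num), unitCount_of_ne (by norm_num) (by norm_num)]
  norm_num

/-- **Thm. 1.3 at `(−7, −163)`**: `J^8 = (262537412640764625)^8 = (68925893036107117107880304651390625)^4 = (∏ₓ F)^(w₁w₂)`.
[cite: GrossZagier1985SingularModuli, Theorem 1.3] -/
theorem singularModuli_neg_seven_neg_oneSixtyThree :
    J (-7) (-163) ^ 8 = ((rhs (-7) (-163) : ℚ) : ℂ) ^ (unitCount (-7) * unitCount (-163)) := by
  rw [J_neg_seven_neg_oneSixtyThree, rhs_neg_seven_neg_oneSixtyThree,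
    unitCount_of_ne (by norm_num) (by norm_num), unitCount_of_ne (by norm_num) (by norm_num)]
  norm_num

/-- **Thm. 1.3 at `(−8, −11)`**: `J^8 = (40768)^8 = (1662029824)^4 = (∏ₓ F)^(w₁w₂)`.
[cite: GrossZagier1985SingularModuli, Theorem 1.3] -/
theorem singularModuli_neg_eight_neg_eleven :
    J (-8) (-11) ^ 8 = ((rhs (-8) (-11) : ℚ) : ℂ) ^ (unitCount (-8) * unitCount (-11)) := by
  rw [J_neg_eight_neg_eleven, rhs_neg_eight_neg_eleven,
    unitCount_of_ne (by norm_num) (by norm_num), unitCount_of_ne (by norm_num) (by norm_num)]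
  norm_num

/-- **Thm. 1.3 at `(−8, −19)`**: `J^8 = (892736)^8 = (796977565696)^4 = (∏ₓ F)^(w₁w₂)`.
[cite: GrossZagier1985SingularModuli, Theorem 1.3] -/
theorem singularModuli_neg_eight_neg_nineteen :
    J (-8) (-19) ^ 8 = ((rhs (-8) (-19) : ℚ) : ℂ) ^ (unitCount (-8) * unitCount (-19)) := by
  rw [J_neg_eight_neg_nineteen, rhs_neg_eight_neg_nineteen,
    unitCount_of_ne (by norm_num) (by norm_num), unitCount_of_ne (by norm_num) (by norm_num)]
  norm_num

/-- **Thm. 1.3 at `(−8, −43)`**: `J^8 = (884744000)^8 = (782771945536000000)^4 = (∏ₓ F)^(w₁w₂)`.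
[cite: GrossZagier1985SingularModuli, Theorem 1.3] -/
theorem singularModuli_neg_eight_neg_fortyThree :
    J (-8) (-43) ^ 8 = ((rhs (-8) (-43) : ℚ) : ℂ) ^ (unitCount (-8) * unitCount (-43)) := by
  rw [J_neg_eight_neg_fortyThree, rhs_neg_eight_neg_fortyThree,
    unitCount_of_ne (by norm_num) (by norm_num), unitCount_of_ne (by norm_num) (by norm_num)]
  norm_num

/-- **Thm. 1.3 at `(−8, −67)`**: `J^8 = (147197960000)^8 = (21667239428161600000000)^4 = (∏ₓ F)^(w₁w₂)`.
[cite: GrossZagier1985SingularModuli, Theorem 1.3] -/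
theorem singularModuli_neg_eight_neg_sixtySeven :
    J (-8) (-67) ^ 8 = ((rhs (-8) (-67) : ℚ) : ℂ) ^ (unitCount (-8) * unitCount (-67)) := by
  rw [J_neg_eight_neg_sixtySeven, rhs_neg_eight_neg_sixtySeven,
    unitCount_of_ne (by norm_num) (by norm_num), unitCount_of_ne (by norm_num) (by norm_num)]
  norm_num

/-- **Thm. 1.3 at `(−8, −163)`**: `J^8 = (262537412640776000)^8 = (68925893036113089834017882176000000)^4 = (∏ₓ F)^(w₁w₂)`.
[cite: GrossZagier1985SingularModuli, Theorem 1.3] -/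
theorem singularModuli_neg_eight_neg_oneSixtyThree :
    J (-8) (-163) ^ 8 = ((rhs (-8) (-163) : ℚ) : ℂ) ^ (unitCount (-8) * unitCount (-163)) := by
  rw [J_neg_eight_neg_oneSixtyThree, rhs_neg_eight_neg_oneSixtyThree,
    unitCount_of_ne (by norm_num) (by norm_num), unitCount_of_ne (by norm_num) (by norm_num)]
  norm_num

/-- **Thm. 1.3 at `(−11, −19)`**: `J^8 = (851968)^8 = (725849473024)^4 = (∏ₓ F)^(w₁w₂)`.
[cite: GrossZagier1985SingularModuli, Theorem 1.3] -/
theorem singularModuli_neg_eleven_neg_nineteen :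
    J (-11) (-19) ^ 8 = ((rhs (-11) (-19) : ℚ) : ℂ) ^ (unitCount (-11) * unitCount (-19)) := by
  rw [J_neg_eleven_neg_nineteen, rhs_neg_eleven_neg_nineteen,
    unitCount_of_ne (by norm_num) (by norm_num), unitCount_of_ne (by norm_num) (by norm_num)]
  norm_num

/-- **Thm. 1.3 at `(−11, −43)`**: `J^8 = (884703232)^8 = (782699808711245824)^4 = (∏ₓ F)^(w₁w₂)`.
[cite: GrossZagier1985SingularModuli, Theorem 1.3] -/
theorem singularModuli_neg_eleven_neg_fortyThree :
    J (-11) (-43) ^ 8 = ((rhs (-11) (-43) : ℚ) : ℂ) ^ (unitCount (-11) * unitCount (-43)) := by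
  rw [J_neg_eleven_neg_fortyThree, rhs_neg_eleven_neg_fortyThree,
    unitCount_of_ne (by norm_num) (by norm_num), unitCount_of_ne (by norm_num) (by norm_num)]
  norm_num

/-- **Thm. 1.3 at `(−11, −67)`**: `J^8 = (147197919232)^8 = (21667227426230395469824)^4 = (∏ₓ F)^(w₁w₂)`.
[cite: GrossZagier1985SingularModuli, Theorem 1.3] -/
theorem singularModuli_neg_eleven_neg_sixtySeven :
    J (-11) (-67) ^ 8 = ((rhs (-11) (-67) : ℚ) : ℂ) ^ (unitCount (-11) * unitCount (-67)) := by
  rw [J_neg_eleven_neg_sixtySeven, rhs_neg_eleven_neg_sixtySeven,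
    unitCount_of_ne (by norm_num) (by norm_num), unitCount_of_ne (by norm_num) (by norm_num)]
  norm_num

/-- **Thm. 1.3 at `(−11, −163)`**: `J^8 = (262537412640735232)^8 = (68925893036091683583540805526093824)^4 = (∏ₓ F)^(w₁w₂)`.
[cite: GrossZagier1985SingularModuli, Theorem 1.3] -/
theorem singularModuli_neg_eleven_neg_oneSixtyThree :
    J (-11) (-163) ^ 8 = ((rhs (-11) (-163) : ℚ) : ℂ) ^ (unitCount (-11) * unitCount (-163)) := by
  rw [J_neg_eleven_neg_oneSixtyThree, rhs_neg_eleven_neg_oneSixtyThree,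
    unitCount_of_ne (by norm_num) (by norm_num), unitCount_of_ne (by norm_num) (by norm_num)]
  norm_num

/-- **Thm. 1.3 at `(−19, −43)`**: `J^8 = (883851264)^8 = (781193056874397696)^4 = (∏ₓ F)^(w₁w₂)`.
[cite: GrossZagier1985SingularModuli, Theorem 1.3] -/
theorem singularModuli_neg_nineteen_neg_fortyThree :
    J (-19) (-43) ^ 8 = ((rhs (-19) (-43) : ℚ) : ℂ) ^ (unitCount (-19) * unitCount (-43)) := by
  rw [J_neg_nineteen_neg_fortyThree, rhs_neg_nineteen_neg_fortyThree,
    unitCount_of_ne (by norm_num) (by norm_num), unitCount_of_ne (by norm_num) (by norm_num)]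
  norm_num

/-- **Thm. 1.3 at `(−19, −67)`**: `J^8 = (147197067264)^8 = (21666976611122540445696)^4 = (∏ₓ F)^(w₁w₂)`.
[cite: GrossZagier1985SingularModuli, Theorem 1.3] -/
theorem singularModuli_neg_nineteen_neg_sixtySeven :
    J (-19) (-67) ^ 8 = ((rhs (-19) (-67) : ℚ) : ℂ) ^ (unitCount (-19) * unitCount (-67)) := by
  rw [J_neg_nineteen_neg_sixtySeven, rhs_neg_nineteen_neg_sixtySeven,
    unitCount_of_ne (by norm_num) (by norm_num), unitCount_of_ne (by norm_num) (by norm_num)]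
  norm_num

/-- **Thm. 1.3 at `(−19, −163)`**: `J^8 = (262537412639883264)^8 = (68925893035644336634796127547293696)^4 = (∏ₓ F)^(w₁w₂)`.
[cite: GrossZagier1985SingularModuli, Theorem 1.3] -/
theorem singularModuli_neg_nineteen_neg_oneSixtyThree :
    J (-19) (-163) ^ 8 = ((rhs (-19) (-163) : ℚ) : ℂ) ^ (unitCount (-19) * unitCount (-163)) := by
  rw [J_neg_nineteen_neg_oneSixtyThree, rhs_neg_nineteen_neg_oneSixtyThree,
    unitCount_of_ne (by norm_num) (by norm_num), unitCount_of_ne (by norm_num) (by norm_num)]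
  norm_num

/-- **Thm. 1.3 at `(−43, −67)`**: `J^8 = (146313216000)^8 = (21407557176262656000000)^4 = (∏ₓ F)^(w₁w₂)`.
[cite: GrossZagier1985SingularModuli, Theorem 1.3] -/
theorem singularModuli_neg_fortyThree_neg_sixtySeven :
    J (-43) (-67) ^ 8 = ((rhs (-43) (-67) : ℚ) : ℂ) ^ (unitCount (-43) * unitCount (-67)) := by
  rw [J_neg_fortyThree_neg_sixtySeven, rhs_neg_fortyThree_neg_sixtySeven,
    unitCount_of_ne (by norm_num) (by norm_num), unitCount_of_ne (by norm_num) (by norm_num)]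
  norm_num

/-- **Thm. 1.3 at `(−43, −163)`**: `J^8 = (262537411756032000)^8 = (68925892571556289397888385024000000)^4 = (∏ₓ F)^(w₁w₂)`.
[cite: GrossZagier1985SingularModuli, Theorem 1.3] -/
theorem singularModuli_neg_fortyThree_neg_oneSixtyThree :
    J (-43) (-163) ^ 8 = ((rhs (-43) (-163) : ℚ) : ℂ) ^ (unitCount (-43) * unitCount (-163)) := by
  rw [J_neg_fortyThree_neg_oneSixtyThree, rhs_neg_fortyThree_neg_oneSixtyThree,
    unitCount_of_ne (by norm_num) (by norm_num), unitCount_of_ne (by norm_num) (by norm_num)]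
  norm_num

/-- **Thm. 1.3 at `(−67, −163)`**: `J^8 = (262537265442816000)^8 = (68925815746191628272566009856000000)^4 = (∏ₓ F)^(w₁w₂)`.
[cite: GrossZagier1985SingularModuli, Theorem 1.3] -/
theorem singularModuli_neg_sixtySeven_neg_oneSixtyThree :
    J (-67) (-163) ^ 8 = ((rhs (-67) (-163) : ℚ) : ℂ) ^ (unitCount (-67) * unitCount (-163)) := by
  rw [J_neg_sixtySeven_neg_oneSixtyThree, rhs_neg_sixtySeven_neg_oneSixtyThree,
    unitCount_of_ne (by norm_num) (by norm_num), unitCount_of_ne (by norm_num) (by norm_num)]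
  norm_num

/-! ### §4. The choice of `dᵢ` in `ε(p)` is immaterial: `rhs d₂ d₁ = rhs d₁ d₂` for coprime discriminants

Gross–Zagier define `ε(p) = (dᵢ/p)` for an `i` with `p ∤ dᵢ`; the typed `GrossZagier1985.epsPrime` fixes
`i = 1` unless `p ∣ d₁`. The lemmas below prove, for the typed functions, that at every prime that
actually occurs (a divisor of some `(d₁d₂ − x²)/4`) the two choices agree when `gcd(d₁, d₂) = 1`, so
that the right-hand side is symmetric in `(d₁, d₂)` for coprime discriminants `≡ 0, 1 (mod 4)`:
if `p ∤ d₁d₂` and `p ∣ d₁d₂ − x²` then `p ∤ x`, `(d₁d₂/p) = (x²/p) = 1`, so `(d₁/p) = (d₂/p)`; at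
`p = 2` with `d₁, d₂` odd, `8 ∣ d₁d₂ − x²` with `x` odd forces `d₁d₂ ≡ 1 (mod 8)`, i.e. `d₁ ≡ d₂ (mod 8)`. -/

/-- The index set `xRange` only depends on the product `d₁d₂`.
[cite: GrossZagier1985SingularModuli, Theorem 1.3 (index set of the product)] -/
theorem xRange_comm (d₁ d₂ : ℤ) : xRange d₂ d₁ = xRange d₁ d₂ := by
  rw [xRange, xRange, mul_comm d₂ d₁]

/-- Odd residues modulo `8` are self-inverse: `ab = c²` in `ℤ/8` with `a, b` odd forces `a = b`. [folklore] -/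
private theorem zmod8_key : ∀ a b c : ZMod 8, (a = 1 ∨ a = 3 ∨ a = 5 ∨ a = 7) →
    (b = 1 ∨ b = 3 ∨ b = 5 ∨ b = 7) → a * b = c ^ 2 → a = b := by
  decide

/-- An odd integer is `1, 3, 5` or `7` in `ℤ/8`. [folklore] -/
private theorem zmod8_odd {d : ℤ} (hd : ¬ (2 : ℤ) ∣ d) :
    (d : ZMod 8) = 1 ∨ (d : ZMod 8) = 3 ∨ (d : ZMod 8) = 5 ∨ (d : ZMod 8) = 7 := by
  have h8 : d % 8 = 1 ∨ d % 8 = 3 ∨ d % 8 = 5 ∨ d % 8 = 7 := by omega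
  rw [← ZMod.intCast_mod d 8]
  simp only [Nat.cast_ofNat]
  rcases h8 with h | h | h | h <;> rw [h] <;> decide

/-- At `p = 2`: for odd `d₁, d₂` with `8 ∣ d₁d₂ − x²` the Kronecker symbols `(d₁/2)`, `(d₂/2)` (the
mod-`8` rule) agree. [cite: Cox2013, §1.C (1.18)] -/
private theorem kroneckerPrime_two_eq {d₁ d₂ x : ℤ} (h1 : ¬ (2 : ℤ) ∣ d₁) (h2 : ¬ (2 : ℤ) ∣ d₂)
    (h8 : (8 : ℤ) ∣ d₁ * d₂ - x ^ 2) : kroneckerPrime d₂ 2 = kroneckerPrime d₁ 2 := by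
  have hz : ((d₁ : ZMod 8)) * (d₂ : ZMod 8) = (x : ZMod 8) ^ 2 := by
    have := (ZMod.intCast_zmod_eq_zero_iff_dvd (d₁ * d₂ - x ^ 2) 8).mpr h8
    push_cast at this
    exact sub_eq_zero.mp this
  have heq := zmod8_key _ _ _ (zmod8_odd h1) (zmod8_odd h2) hz
  have hmod : d₁ % 8 = d₂ % 8 := by
    have := (ZMod.intCast_eq_intCast_iff' _ _ _).mp heq
    simpa using this
  simp only [kroneckerPrime, if_true, h1, h2, if_false, hmod]

/-- At an odd prime `p ∤ d₁d₂` with `p ∣ d₁d₂ − x²`: `p ∤ x`, `(d₁d₂/p) = (x²/p) = 1`, hence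
`(d₁/p) = (d₂/p)`. [cite: GrossZagier1985SingularModuli, Theorem 1.3 (definition of ε)] -/
private theorem jacobiSym_eq_of_dvd {d₁ d₂ x : ℤ} {p : ℕ} (hp : p.Prime)
    (h1 : ¬ (p : ℤ) ∣ d₁) (h2 : ¬ (p : ℤ) ∣ d₂) (hdiv : (p : ℤ) ∣ d₁ * d₂ - x ^ 2) :
    J(d₂ | p) = J(d₁ | p) := by
  have hpZ : Prime (p : ℤ) := Nat.prime_iff_prime_int.mp hp
  have hx : ¬ (p : ℤ) ∣ x := by
    intro hx
    have : (p : ℤ) ∣ d₁ * d₂ := by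
      have := dvd_add hdiv (dvd_mul_of_dvd_left hx x)
      simpa [sq] using this
    rcases hpZ.dvd_or_dvd this with h | h
    · exact h1 h
    · exact h2 h
  have gcd_of_not_dvd : ∀ {a : ℤ}, ¬ (p : ℤ) ∣ a → a.gcd p = 1 := fun {a} ha =>
    Int.isCoprime_iff_gcd_eq_one.mp ((Irreducible.coprime_iff_not_dvd hpZ.irreducible).mpr ha).symm
  have hsq : J(x ^ 2 | p) = 1 := jacobiSym.sq_one' (gcd_of_not_dvd hx)
  have hmod : J(d₁ * d₂ | p) = J(x ^ 2 | p) := by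
    rw [jacobiSym.mod_left (d₁ * d₂), jacobiSym.mod_left (x ^ 2)]
    congr 1
    have h' : (p : ℤ) ∣ x ^ 2 - d₁ * d₂ := by rw [← neg_sub]; exact dvd_neg.mpr hdiv
    exact Int.modEq_iff_dvd.mpr h'
  rw [hsq, jacobiSym.mul_left] at hmod
  rcases jacobiSym.eq_one_or_neg_one (gcd_of_not_dvd h1) with ha | ha <;>
    rcases jacobiSym.eq_one_or_neg_one (gcd_of_not_dvd h2) with hb | hb <;>
    simp [ha, hb] at hmod ⊢

/-- **The choice of `dᵢ` in `ε(p)` is immaterial** at the primes that occur: for coprime `d₁, d₂`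
and a prime `p ∣ m` with `4m = d₁d₂ − x²`, the typed `ε(p)` computed with the roles of `d₁, d₂`
exchanged agrees ("choose `i` such that `p ∤ dᵢ` and define `ε(p) = (dᵢ/p)`").
[cite: GrossZagier1985SingularModuli, Theorem 1.3 (definition of ε)] -/
theorem epsPrime_comm_of_dvd {d₁ d₂ x : ℤ} {m : ℕ} (hg : Int.gcd d₁ d₂ = 1)
    (hm : 4 * (m : ℤ) = d₁ * d₂ - x ^ 2) {p : ℕ} (hp : p.Prime) (hpm : p ∣ m) :
    epsPrime d₂ d₁ p = epsPrime d₁ d₂ p := by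
  have hdiv : (p : ℤ) ∣ d₁ * d₂ - x ^ 2 := by
    rw [← hm]
    exact Dvd.dvd.mul_left (Int.natCast_dvd_natCast.mpr hpm) 4
  unfold epsPrime
  by_cases h1 : (p : ℤ) ∣ d₁ <;> by_cases h2 : (p : ℤ) ∣ d₂
  · exfalso
    have hg' : (p : ℤ) ∣ (Int.gcd d₁ d₂ : ℤ) := Int.dvd_coe_gcd h1 h2
    rw [hg] at hg'
    exact hp.one_lt.ne' (by exact_mod_cast Int.eq_one_of_dvd_one (by positivity) hg')
  · simp [h1, h2]
  · simp [h1, h2]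
  · simp only [h1, h2, if_false]
    by_cases hp2 : p = 2
    · subst hp2
      have h1' : ¬ (2 : ℤ) ∣ d₁ := by exact_mod_cast h1
      have h2' : ¬ (2 : ℤ) ∣ d₂ := by exact_mod_cast h2
      have h8 : (8 : ℤ) ∣ d₁ * d₂ - x ^ 2 := by
        rw [← hm]
        obtain ⟨k, hk⟩ := hpm
        exact ⟨k, by rw [hk]; push_cast; ring⟩
      exact_mod_cast kroneckerPrime_two_eq h1' h2' h8
    · have hk : ∀ d : ℤ, kroneckerPrime d p = J(d | p) := fun d => by simp [kroneckerPrime, hp2]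
      rw [hk, hk]
      exact jacobiSym_eq_of_dvd hp h1 h2 hdiv

/-- `ε(n)` is unchanged under exchanging `d₁, d₂`, for `n ∣ m`, `4m = d₁d₂ − x²`, `gcd(d₁, d₂) = 1`.
[cite: GrossZagier1985SingularModuli, Theorem 1.3 (definition of ε)] -/
theorem eps_comm_of_dvd {d₁ d₂ x : ℤ} {m : ℕ} (hg : Int.gcd d₁ d₂ = 1)
    (hm : 4 * (m : ℤ) = d₁ * d₂ - x ^ 2) {n : ℕ} (hn : n ∣ m) :
    eps d₂ d₁ n = eps d₁ d₂ n := by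
  unfold eps
  simp only [Finsupp.prod]
  refine Finset.prod_congr rfl fun p hp => ?_
  rw [Nat.support_factorization, Nat.mem_primeFactors] at hp
  rw [epsPrime_comm_of_dvd hg hm hp.1 (dvd_trans hp.2.1 hn)]

/-- `F(m)` is unchanged under exchanging `d₁, d₂`, for `4m = d₁d₂ − x²`, `gcd(d₁, d₂) = 1`.
[cite: GrossZagier1985SingularModuli, Theorem 1.3 (definition of F)] -/
theorem F_comm_of_eq {d₁ d₂ x : ℤ} {m : ℕ} (hg : Int.gcd d₁ d₂ = 1)
    (hm : 4 * (m : ℤ) = d₁ * d₂ - x ^ 2) : F d₂ d₁ m = F d₁ d₂ m := by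
  unfold F
  refine Finset.prod_congr rfl fun n hn => ?_
  rw [eps_comm_of_dvd hg hm (Nat.div_dvd_of_dvd (Nat.dvd_of_mem_divisors hn))]

/-- In `ℤ/4`: `a, b ∈ {0, 1}` and `2c = 2ab` give `ab = c²`. [folklore] -/
private theorem zmod4_key : ∀ a b c : ZMod 4, (a = 0 ∨ a = 1) → (b = 0 ∨ b = 1) →
    2 * c = 2 * (a * b) → a * b - c ^ 2 = 0 := by
  decide

/-- `d ≡ 0, 1 (mod 4)` read in `ℤ/4`. [folklore] -/
private theorem zmod4_of_emod {d : ℤ} (h : d % 4 = 0 ∨ d % 4 = 1) :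
    (d : ZMod 4) = 0 ∨ (d : ZMod 4) = 1 := by
  rw [← ZMod.intCast_mod d 4]
  simp only [Nat.cast_ofNat]
  rcases h with h | h <;> rw [h] <;> decide

/-- For discriminants `d₁, d₂ ≡ 0, 1 (mod 4)` and `x ≡ d₁d₂ (mod 2)` the number `(d₁d₂ − x²)/4` of
Theorem 1.3 is an integer: `4 ∣ d₁d₂ − x²`.
[cite: GrossZagier1985SingularModuli, Theorem 1.3 (index set of the product)] -/
theorem four_dvd_of_mem_xRange {d₁ d₂ x : ℤ} (h₁ : d₁ % 4 = 0 ∨ d₁ % 4 = 1)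
    (h₂ : d₂ % 4 = 0 ∨ d₂ % 4 = 1) (hpar : x % 2 = (d₁ * d₂) % 2) :
    (4 : ℤ) ∣ d₁ * d₂ - x ^ 2 := by
  have h2 : (2 : ℤ) ∣ d₁ * d₂ - x := Int.ModEq.dvd hpar
  have h4 : (4 : ℤ) ∣ 2 * (d₁ * d₂ - x) := by
    obtain ⟨k, hk⟩ := h2
    exact ⟨k, by rw [hk]; ring⟩
  have hz : (2 : ZMod 4) * (x : ZMod 4) = 2 * ((d₁ : ZMod 4) * (d₂ : ZMod 4)) := by
    have := (ZMod.intCast_zmod_eq_zero_iff_dvd (2 * (d₁ * d₂ - x)) 4).mpr h4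
    push_cast at this
    linear_combination -this
  have := zmod4_key _ _ _ (zmod4_of_emod h₁) (zmod4_of_emod h₂) hz
  refine (ZMod.intCast_zmod_eq_zero_iff_dvd (d₁ * d₂ - x ^ 2) 4).mp ?_
  push_cast
  exact this

/-- **The right-hand side of Theorem 1.3 is symmetric in `(d₁, d₂)`** for coprime `d₁, d₂ ≡ 0, 1
(mod 4)`: it does not depend on which `dᵢ` prime to `p` defines `ε(p)`.
[cite: GrossZagier1985SingularModuli, Theorem 1.3 (definition of ε: "choose i such that p ∤ dᵢ")] -/
theorem rhs_comm {d₁ d₂ : ℤ} (h₁ : d₁ % 4 = 0 ∨ d₁ % 4 = 1) (h₂ : d₂ % 4 = 0 ∨ d₂ % 4 = 1)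
    (hg : Int.gcd d₁ d₂ = 1) : rhs d₂ d₁ = rhs d₁ d₂ := by
  unfold rhs
  rw [xRange_comm, mul_comm d₂ d₁]
  refine Finset.prod_congr rfl fun x hx => ?_
  simp only [xRange, Finset.mem_filter, Finset.mem_Icc] at hx
  obtain ⟨-, hlt, hpar⟩ := hx
  have h4 := four_dvd_of_mem_xRange h₁ h₂ hpar
  have hnn : 0 ≤ (d₁ * d₂ - x ^ 2) / 4 := Int.ediv_nonneg (by linarith) (by norm_num)
  have hm : 4 * (((d₁ * d₂ - x ^ 2) / 4).toNat : ℤ) = d₁ * d₂ - x ^ 2 := by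
    rw [Int.toNat_of_nonneg hnn, Int.mul_ediv_cancel' h4]
  exact F_comm_of_eq (Int.gcd_comm d₁ d₂ ▸ hg) hm

/-! ### §5. Theorem 1.3 on the nine class-number-one fundamental discriminants (`cmDiscrs`) -/

/-- Exchanging `d₁, d₂` changes the sign of `J` when both class numbers are one. [folklore] -/
private theorem J_comm_of_singleton {d₁ d₂ : ℤ} {f g : BinQF} (h₁ : BinQF.reducedFormsList d₁ = [f])
    (h₂ : BinQF.reducedFormsList d₂ = [g]) : J d₂ d₁ = -J d₁ d₂ := by
  rw [J_of_singleton h₂ h₁, J_of_singleton h₁ h₂]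
  ring

/-- Transport of an instance of Theorem 1.3 to the exchanged pair (class numbers one, coprime
discriminants `≡ 0, 1 (mod 4)`): `J ↦ −J`, `rhs` and `w₁w₂` symmetric. [folklore] -/
private theorem singularModuli_swap {d₁ d₂ : ℤ} {f g : BinQF}
    (h₁ : BinQF.reducedFormsList d₁ = [f]) (h₂ : BinQF.reducedFormsList d₂ = [g])
    (h4₁ : d₁ % 4 = 0 ∨ d₁ % 4 = 1) (h4₂ : d₂ % 4 = 0 ∨ d₂ % 4 = 1) (hg : Int.gcd d₁ d₂ = 1)
    (h : J d₁ d₂ ^ 8 = ((rhs d₁ d₂ : ℚ) : ℂ) ^ (unitCount d₁ * unitCount d₂)) :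
    J d₂ d₁ ^ 8 = ((rhs d₂ d₁ : ℚ) : ℂ) ^ (unitCount d₂ * unitCount d₁) := by
  rw [J_comm_of_singleton h₁ h₂, Even.neg_pow (by decide), rhs_comm h4₁ h4₂ hg, mul_comm]
  exact h

/-- The nine class-number-one fundamental discriminants are negative fundamental discriminants in the
sense of the typed fact (`IsFundamentalDiscriminant`: `d ≡ 1 (mod 4)` square-free, or `4m` with
`m ≡ 2, 3 (mod 4)` square-free). [cite: Cox2013, §7.D Thm. 7.30] -/
theorem isFundamentalDiscriminant_of_mem_cmDiscrs {d : ℤ} (hd : d ∈ cmDiscrs) :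
    d < 0 ∧ Literature.Barriers.RiemannHypothesis.IsFundamentalDiscriminant d := by
  have sqf : ∀ p : ℕ, p.Prime → Squarefree (-(p : ℤ)) := fun p hp =>
    (Int.prime_iff_natAbs_prime.2 (by simpa using hp)).neg.squarefree
  simp only [cmDiscrs, Finset.mem_insert, Finset.mem_singleton] at hd
  rcases hd with rfl | rfl | rfl | rfl | rfl | rfl | rfl | rfl | rfl
  · exact ⟨by norm_num, Or.inl ⟨by decide, by exact_mod_cast sqf 3 (by norm_num), by decide⟩⟩
  · exact ⟨by norm_num, Or.inr ⟨by decide, by decide, by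
      rw [show (-4 : ℤ) / 4 = -1 by decide]; exact isUnit_one.neg.squarefree⟩⟩
  · exact ⟨by norm_num, Or.inl ⟨by decide, by exact_mod_cast sqf 7 (by norm_num), by decide⟩⟩
  · exact ⟨by norm_num, Or.inr ⟨by decide, by decide, by
      rw [show (-8 : ℤ) / 4 = -2 by decide]; exact_mod_cast sqf 2 (by norm_num)⟩⟩
  · exact ⟨by norm_num, Or.inl ⟨by decide, by exact_mod_cast sqf 11 (by norm_num), by decide⟩⟩
  · exact ⟨by norm_num, Or.inl ⟨by decide, by exact_mod_cast sqf 19 (by norm_num), by decide⟩⟩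
  · exact ⟨by norm_num, Or.inl ⟨by decide, by exact_mod_cast sqf 43 (by norm_num), by decide⟩⟩
  · exact ⟨by norm_num, Or.inl ⟨by decide, by exact_mod_cast sqf 67 (by norm_num), by decide⟩⟩
  · exact ⟨by norm_num, Or.inl ⟨by decide, by exact_mod_cast sqf 163 (by norm_num), by decide⟩⟩

/-- **Gross–Zagier, Theorem 1.3 on the class-number-one fundamental discriminants.** For all
`d₁, d₂ ∈ {−3, −4, −7, −8, −11, −19, −43, −67, −163}` (`cmDiscrs`) with `gcd(d₁, d₂) = 1` (this
excludes `d₁ = d₂` and `{d₁, d₂} = {−4, −8}`; 70 ordered pairs remain),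
`J(d₁, d₂)^8 = (∏_{x² < d₁d₂, x ≡ d₁d₂ (2)} F((d₁d₂ − x²)/4))^{w₁w₂}` — the body of the named fact
`grossZagier1985_singularModuli` at these arguments (they satisfy its hypotheses:
`isFundamentalDiscriminant_of_mem_cmDiscrs`), as a theorem: the 35 instances of §3 (with lit-g45's
`grossZagier1985_neg_three_neg_four`) and their transports under `(d₁, d₂) ↦ (d₂, d₁)` (§4).
[cite: GrossZagier1985SingularModuli, Theorem 1.3] -/
theorem grossZagier1985_singularModuli_of_mem_cmDiscrs {d₁ d₂ : ℤ} (hd₁ : d₁ ∈ cmDiscrs)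
    (hd₂ : d₂ ∈ cmDiscrs) (hg : Int.gcd d₁ d₂ = 1) :
    J d₁ d₂ ^ 8 = ((rhs d₁ d₂ : ℚ) : ℂ) ^ (unitCount d₁ * unitCount d₂) := by
  simp only [cmDiscrs, Finset.mem_insert, Finset.mem_singleton] at hd₁ hd₂
  rcases hd₁ with rfl | rfl | rfl | rfl | rfl | rfl | rfl | rfl | rfl <;>
    rcases hd₂ with rfl | rfl | rfl | rfl | rfl | rfl | rfl | rfl | rfl
  · exact absurd hg (by decide)
  · exact grossZagier1985_neg_three_neg_four
  · exact singularModuli_neg_three_neg_seven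
  · exact singularModuli_neg_three_neg_eight
  · exact singularModuli_neg_three_neg_eleven
  · exact singularModuli_neg_three_neg_nineteen
  · exact singularModuli_neg_three_neg_fortyThree
  · exact singularModuli_neg_three_neg_sixtySeven
  · exact singularModuli_neg_three_neg_oneSixtyThree
  · exact singularModuli_swap (show BinQF.reducedFormsList (-3) = [⟨1, 1, 1⟩] by decide) (show BinQF.reducedFormsList (-4) = [⟨1, 0, 1⟩] by decide)
      (by decide) (by decide) (by decide) grossZagier1985_neg_three_neg_four
  · exact absurd hg (by decide)
  · exact singularModuli_neg_four_neg_seven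
  · exact absurd hg (by decide)
  · exact singularModuli_neg_four_neg_eleven
  · exact singularModuli_neg_four_neg_nineteen
  · exact singularModuli_neg_four_neg_fortyThree
  · exact singularModuli_neg_four_neg_sixtySeven
  · exact singularModuli_neg_four_neg_oneSixtyThree
  · exact singularModuli_swap (show BinQF.reducedFormsList (-3) = [⟨1, 1, 1⟩] by decide) reducedFormsList_neg_seven
      (by decide) (by decide) (by decide) singularModuli_neg_three_neg_seven
  · exact singularModuli_swap (show BinQF.reducedFormsList (-4) = [⟨1, 0, 1⟩] by decide) reducedFormsList_neg_seven
      (by decide) (by decide) (by decide) singularModuli_neg_four_neg_seven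
  · exact absurd hg (by decide)
  · exact singularModuli_neg_seven_neg_eight
  · exact singularModuli_neg_seven_neg_eleven
  · exact singularModuli_neg_seven_neg_nineteen
  · exact singularModuli_neg_seven_neg_fortyThree
  · exact singularModuli_neg_seven_neg_sixtySeven
  · exact singularModuli_neg_seven_neg_oneSixtyThree
  · exact singularModuli_swap (show BinQF.reducedFormsList (-3) = [⟨1, 1, 1⟩] by decide) reducedFormsList_neg_eight
      (by decide) (by decide) (by decide) singularModuli_neg_three_neg_eight
  · exact absurd hg (by decide)
  · exact singularModuli_swap reducedFormsList_neg_seven reducedFormsList_neg_eight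
      (by decide) (by decide) (by decide) singularModuli_neg_seven_neg_eight
  · exact absurd hg (by decide)
  · exact singularModuli_neg_eight_neg_eleven
  · exact singularModuli_neg_eight_neg_nineteen
  · exact singularModuli_neg_eight_neg_fortyThree
  · exact singularModuli_neg_eight_neg_sixtySeven
  · exact singularModuli_neg_eight_neg_oneSixtyThree
  · exact singularModuli_swap (show BinQF.reducedFormsList (-3) = [⟨1, 1, 1⟩] by decide) reducedFormsList_neg_eleven
      (by decide) (by decide) (by decide) singularModuli_neg_three_neg_eleven
  · exact singularModuli_swap (show BinQF.reducedFormsList (-4) = [⟨1, 0, 1⟩] by decide) reducedFormsList_neg_eleven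
      (by decide) (by decide) (by decide) singularModuli_neg_four_neg_eleven
  · exact singularModuli_swap reducedFormsList_neg_seven reducedFormsList_neg_eleven
      (by decide) (by decide) (by decide) singularModuli_neg_seven_neg_eleven
  · exact singularModuli_swap reducedFormsList_neg_eight reducedFormsList_neg_eleven
      (by decide) (by decide) (by decide) singularModuli_neg_eight_neg_eleven
  · exact absurd hg (by decide)
  · exact singularModuli_neg_eleven_neg_nineteen
  · exact singularModuli_neg_eleven_neg_fortyThree
  · exact singularModuli_neg_eleven_neg_sixtySeven
  · exact singularModuli_neg_eleven_neg_oneSixtyThree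
  · exact singularModuli_swap (show BinQF.reducedFormsList (-3) = [⟨1, 1, 1⟩] by decide) reducedFormsList_neg_nineteen
      (by decide) (by decide) (by decide) singularModuli_neg_three_neg_nineteen
  · exact singularModuli_swap (show BinQF.reducedFormsList (-4) = [⟨1, 0, 1⟩] by decide) reducedFormsList_neg_nineteen
      (by decide) (by decide) (by decide) singularModuli_neg_four_neg_nineteen
  · exact singularModuli_swap reducedFormsList_neg_seven reducedFormsList_neg_nineteen
      (by decide) (by decide) (by decide) singularModuli_neg_seven_neg_nineteen
  · exact singularModuli_swap reducedFormsList_neg_eight reducedFormsList_neg_nineteen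
      (by decide) (by decide) (by decide) singularModuli_neg_eight_neg_nineteen
  · exact singularModuli_swap reducedFormsList_neg_eleven reducedFormsList_neg_nineteen
      (by decide) (by decide) (by decide) singularModuli_neg_eleven_neg_nineteen
  · exact absurd hg (by decide)
  · exact singularModuli_neg_nineteen_neg_fortyThree
  · exact singularModuli_neg_nineteen_neg_sixtySeven
  · exact singularModuli_neg_nineteen_neg_oneSixtyThree
  · exact singularModuli_swap (show BinQF.reducedFormsList (-3) = [⟨1, 1, 1⟩] by decide) reducedFormsList_neg_fortyThree
      (by decide) (by decide) (by decide) singularModuli_neg_three_neg_fortyThree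
  · exact singularModuli_swap (show BinQF.reducedFormsList (-4) = [⟨1, 0, 1⟩] by decide) reducedFormsList_neg_fortyThree
      (by decide) (by decide) (by decide) singularModuli_neg_four_neg_fortyThree
  · exact singularModuli_swap reducedFormsList_neg_seven reducedFormsList_neg_fortyThree
      (by decide) (by decide) (by decide) singularModuli_neg_seven_neg_fortyThree
  · exact singularModuli_swap reducedFormsList_neg_eight reducedFormsList_neg_fortyThree
      (by decide) (by decide) (by decide) singularModuli_neg_eight_neg_fortyThree
  · exact singularModuli_swap reducedFormsList_neg_eleven reducedFormsList_neg_fortyThree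
      (by decide) (by decide) (by decide) singularModuli_neg_eleven_neg_fortyThree
  · exact singularModuli_swap reducedFormsList_neg_nineteen reducedFormsList_neg_fortyThree
      (by decide) (by decide) (by decide) singularModuli_neg_nineteen_neg_fortyThree
  · exact absurd hg (by decide)
  · exact singularModuli_neg_fortyThree_neg_sixtySeven
  · exact singularModuli_neg_fortyThree_neg_oneSixtyThree
  · exact singularModuli_swap (show BinQF.reducedFormsList (-3) = [⟨1, 1, 1⟩] by decide) reducedFormsList_neg_sixtySeven
      (by decide) (by decide) (by decide) singularModuli_neg_three_neg_sixtySeven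
  · exact singularModuli_swap (show BinQF.reducedFormsList (-4) = [⟨1, 0, 1⟩] by decide) reducedFormsList_neg_sixtySeven
      (by decide) (by decide) (by decide) singularModuli_neg_four_neg_sixtySeven
  · exact singularModuli_swap reducedFormsList_neg_seven reducedFormsList_neg_sixtySeven
      (by decide) (by decide) (by decide) singularModuli_neg_seven_neg_sixtySeven
  · exact singularModuli_swap reducedFormsList_neg_eight reducedFormsList_neg_sixtySeven
      (by decide) (by decide) (by decide) singularModuli_neg_eight_neg_sixtySeven
  · exact singularModuli_swap reducedFormsList_neg_eleven reducedFormsList_neg_sixtySeven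
      (by decide) (by decide) (by decide) singularModuli_neg_eleven_neg_sixtySeven
  · exact singularModuli_swap reducedFormsList_neg_nineteen reducedFormsList_neg_sixtySeven
      (by decide) (by decide) (by decide) singularModuli_neg_nineteen_neg_sixtySeven
  · exact singularModuli_swap reducedFormsList_neg_fortyThree reducedFormsList_neg_sixtySeven
      (by decide) (by decide) (by decide) singularModuli_neg_fortyThree_neg_sixtySeven
  · exact absurd hg (by decide)
  · exact singularModuli_neg_sixtySeven_neg_oneSixtyThree
  · exact singularModuli_swap (show BinQF.reducedFormsList (-3) = [⟨1, 1, 1⟩] by decide) reducedFormsList_neg_oneSixtyThree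
      (by decide) (by decide) (by decide) singularModuli_neg_three_neg_oneSixtyThree
  · exact singularModuli_swap (show BinQF.reducedFormsList (-4) = [⟨1, 0, 1⟩] by decide) reducedFormsList_neg_oneSixtyThree
      (by decide) (by decide) (by decide) singularModuli_neg_four_neg_oneSixtyThree
  · exact singularModuli_swap reducedFormsList_neg_seven reducedFormsList_neg_oneSixtyThree
      (by decide) (by decide) (by decide) singularModuli_neg_seven_neg_oneSixtyThree
  · exact singularModuli_swap reducedFormsList_neg_eight reducedFormsList_neg_oneSixtyThree
      (by decide) (by decide) (by decide) singularModuli_neg_eight_neg_oneSixtyThree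
  · exact singularModuli_swap reducedFormsList_neg_eleven reducedFormsList_neg_oneSixtyThree
      (by decide) (by decide) (by decide) singularModuli_neg_eleven_neg_oneSixtyThree
  · exact singularModuli_swap reducedFormsList_neg_nineteen reducedFormsList_neg_oneSixtyThree
      (by decide) (by decide) (by decide) singularModuli_neg_nineteen_neg_oneSixtyThree
  · exact singularModuli_swap reducedFormsList_neg_fortyThree reducedFormsList_neg_oneSixtyThree
      (by decide) (by decide) (by decide) singularModuli_neg_fortyThree_neg_oneSixtyThree
  · exact singularModuli_swap reducedFormsList_neg_sixtySeven reducedFormsList_neg_oneSixtyThree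
      (by decide) (by decide) (by decide) singularModuli_neg_sixtySeven_neg_oneSixtyThree
  · exact absurd hg (by decide)

end GrossZagier1985

end Literature.NumberTheory.EllipticCurves
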